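import Literature.MathematicalPhysics.QuantumLattice.SpinGaugedHubbardTorus
import Literature.MathematicalPhysics.QuantumLattice.FermionGammaFunctor
import HarnessLib

/-!
# Gauge transformations, Gauss law and Elitzur's theorem for the spin-gauged Hubbard torus

Topic `MathematicalPhysics/QuantumLattice` (family `hubbard`); definition request
`defn-spinGaugedHubbardTorus` of route `HubbardSuperconductivity/ColourTheSpin`, part 3 of 3
(part 1: `QuaternionSpinGaugeGroup` — the coded group `Q8` and its spin-½ representation `Q8.rep`;
part 2: `SpinGaugedHubbardTorus` — the Kogut–Susskind Hamiltonian `spinGaugedHubbardTorusWith ρ L`,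
`spinGaugedHubbardTorus L U g` for `Q₈`, the transported `B₁g` pair field, hermiticity and the
trivial-link dictionary). Here, for a finite group `G` with a two-dimensional representation
`ρ : G →* Mat₂(ℂ)` (unitary, resp. of determinant one, where stated):

* the GAUGE GROUP `G^Λ` (`η : FermionTorus 2 L → G`) acting on link configurations,
  `SpinGauged.gaugeAct L η k (x, i) = η_x k_{(x,i)} η_{x+eᵢ}⁻¹` (Bietenholz–Wiese (2025) §11.8
  eqs. (11.56), (11.64): `U'_{x,i} = Ω_x U_{x,i} Ω†_{x+î}`), its permutation representation
  `linkGauge L η` on the group-element basis, the fermionic factor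
  `fermionGauge ρ L η = Γ(⊕_x ρ(η_x))` — the second quantisation (`Gamma`, `FermionGammaFunctor`) of
  the one-body spin rotation `spinRotation (ρ ∘ η)` — and **the unitary gauge transformations**
  `gaugeTransform ρ L η = fermionGauge ρ L η ⊗ₖ linkGauge L η`; the LOCAL transformation at `y` by
  `h ∈ G` (the route's `W_y(h)`) is `gaugeTransform ρ L (Pi.mulSingle y h)`;
* the Gauss-law (gauge-invariant) subspace `gaugeInvariantSubspace ρ L` (joint fixed space of all
  `W(η)`) and the group average `gaugeAverage ρ L = |G|^{-|Λ|} Σ_η W(η)`;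
* the fermionic spin bilinears `spinBil x x' A = Σ_{στ} A_{στ} c†_{xσ} c_{x'τ}` (spin operators
  `S^a_x = spinBil x x (σ^a/2)`, site occupation `spinBil x x 1`) and pair bilinears `pairBil`.

## API (all proved)

* `W` is a unitary representation of `G^Λ`: `gaugeTransform_mul`, `gaugeTransform_one`,
  `gaugeTransform_conjTranspose` (`W(η)ᴴ = W(η⁻¹)`), `gaugeTransform_mem_unitaryGroup`;
* the intertwining relations `Γ(U) c†_{xσ} = (Σ_α u_{ασ} c†_{xα}) Γ(U)`, `Γ(U) c_{xσ} = (Σ_α ū_{ασ} c_{xα}) Γ(U)`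
  (`Gamma_spinRotation_mul_creation/annihilation`, from `Gamma_mul_creation` of
  `FermionGammaFunctor`, Bratteli–Robinson II §5.2.1) and the transformation laws
  `Γ S_{x,x'}(A) Γ⁻¹ = S_{x,x'}(u_x A u_{x'}ᴴ)`, `Γ P_{x,x'}(A) Γ⁻¹ = P_{x,x'}(ū_x A u_{x'}ᴴ)`;
* **GAUGE INVARIANCE** `Commute (gaugeTransform ρ L η) (spinGaugedHubbardTorusWith ρ L U gE gB)` for
  unitary `ρ` (`commute_gaugeTransform_spinGaugedHubbardTorusWith`; term by term:
  `gaugeTransform_mul_hop/interaction/electric/magnetic`), in particular for the `Q₈` torus of the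
  route (`commute_gaugeTransform_spinGaugedHubbardTorus`); gauge invariance of the transported singlet
  pair field for `ρ` unitary with `det ρ = 1` (`commute_gaugeTransform_spinGaugedPairFieldWith`, via
  `ρᴴᵀ ε = ε ρ`) and of the pair order observable `Δ^g† Δ^g` (`commute_gaugeTransform_pairOrder`,
  `commute_gaugeTransform_spinGaugedPairField[_pairOrder]` for `Q₈`);
* `E_b = 1 - Π_b` with `Π_b = linkAverage L b` the link average, and `E_b² = E_b`
  (`electricLink_mul_self`: the electric energy of a bond is a projector);
* the group average is a Hermitian projector commuting with `H` whose fixed vectors are exactly the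
  gauge-invariant ones (`gaugeAverage_mul_self`, `gaugeAverage_isHermitian`,
  `commute_gaugeAverage_spinGaugedHubbardTorusWith`, `gaugeAverage_mulVec_eq_self_iff`,
  `gaugeAverage_mulVec_mem`);
* **ELITZUR'S THEOREM, Hamiltonian form**: in a vector fixed by a finite family `W h` the expectation
  of any `A` with `Σ_h W(h)ᴴ A W(h) = 0` vanishes (`dotProduct_mulVec_eq_zero_of_sum_conj_eq_zero`);
  for the spin: `Γ(η)ᴴ S_{x,x'}(A) Γ(η) = S_{x,x'}(ρ(η_x)ᴴ A ρ(η_{x'}))`, hence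
  `⟨ψ, (S_y(M) ⊗ 1) ψ⟩ = 0` and `⟨ψ, (S_x(M) S_y(M') ⊗ 1) ψ⟩ = 0` (`x ≠ y`) in every state obeying the
  Gauss law at `y`, whenever the group average `Σ_h ρ(h)ᴴ M ρ(h)` of the coefficient matrix vanishes
  (`expect_spinOp_eq_zero`, `expect_spinOp_mul_spinOp_eq_zero`) — for `Q₈` every TRACELESS `M`,
  i.e. every spin component (`q8_expect_spinOp_eq_zero`, `q8_expect_spinOp_mul_spinOp_eq_zero`, from
  `Q8.sum_conjTranspose_rep_mul_mul_rep`: no Néel / spiral / spin-stripe / ferromagnetic one- or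
  two-point function survives the gauging, at any coupling);
* `SU(2)` bookkeeping: `Aᵀ ε A = det A • ε` for all `2 × 2` matrices, reality of `SU(2)` characters
  (`star_trace_of_mem_specialUnitaryGroup`), hence `isHermitian_spinGaugedHubbardTorusWith_of_mem`.

## Design notes

Gauge transformations are GLOBAL gauge functions `η : Λ → G` (a homomorphism `G^Λ → U(ℋ)`); the
local Gauss-law generators of the route are the values at `Pi.mulSingle y h`, and the Elitzur
statements assume only the LOCAL law at the site concerned. The block-diagonal calculus
`linkDiag S = Σ_k S(k) ⊗ |k⟩⟨k|` (`kronecker_perm_mul_linkDiag`) reduces every invariance statement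
to the fermionic transformation law at fixed link configuration plus a relabelling of `k`. The
generic-`Λ` lemmas carry an explicit `[DecidableEq Λ]` besides `[LinearOrder Λ]`: for
`Λ = FermionTorus 2 L` instance search returns the computable `Lex`/`Pi` instance and not the
classical `LinearOrder.toDecidableEq`, so lemmas must be polymorphic in that instance to apply.

## What is NOT here

That the local transformations `W(Pi.mulSingle y h)` GENERATE all `W(η)` (true, `G^Λ` is generated
by its factors; not needed: global invariance is proved directly and Elitzur uses only local
invariance); the spectrum of `Σ_b E_b` beyond `E_b² = E_b`; Elitzur's theorem in its statistical
(path-integral, all temperatures) form; the `g → 0` flat-connection reduction and the confined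
`g → ∞` effective model of the route (items, not literature).

## Sources

S. Elitzur, Phys. Rev. D 12 (1975) 3978 (local symmetries cannot break spontaneously; only
gauge-invariant operators have non-vanishing expectation); J. Kogut, L. Susskind, Phys. Rev. D 11
(1975) 395 (Hamiltonian lattice gauge theory, gauge invariance `[H, G_x] = 0`); W. Bietenholz,
U.-J. Wiese, *Uncovering Quantum Field Theory and the Standard Model* (CUP 2025) §11.8,
eqs. (11.56), (11.63)–(11.64) (`V U_{x,i} V† = Ω_x U_{x,i} Ω†_{x+î}`, non-Abelian Gauss law);
E. Fradkin, S. Shenker, Phys. Rev. D 19 (1979) 3682 §II (gauge-invariant composites); O. Bratteli,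
D. W. Robinson, *Operator Algebras and Quantum Statistical Mechanics 2* §5.2.1 (`Γ(U) a*(f) Γ(U)* = a*(Uf)`).

## Mathlib / tree search

Mathlib: `Matrix.kronecker` (`mul_kronecker_mul`, `conjTranspose_kronecker`), `Matrix.unitaryGroup`,
`Matrix.specialUnitaryGroup`, `Matrix.adjugate_fin_two`, `Pi.mulSingle`, `Equiv.mulLeft`;
no lattice gauge theory, no Elitzur. Tree (REUSED): `Gamma`, `Gamma_mul`, `Gamma_one`,
`Gamma_conjTranspose`, `Gamma_mul_creation` (`FermionGammaFunctor`), `RayleighBound.create`,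
`numberAt_idempotent/commute` (`FermionOperators`), `FermionTorus.shift_shift_comm`
(`GaugedHubbardTorus`), and everything of parts 1–2 (`Q8.rep`, `Q8.eps`,
`Q8.rep_mem_unitaryGroup`, `Q8.det_rep`, `Q8.sum_conjTranspose_rep_mul_mul_rep`, `SpinGauged.hop`,
`electricLink`, `electric`, `magnetic`, `holonomy`, `epsRep`, `spinGaugedHubbardTorusWith`,
`spinGaugedPairFieldWith`).
-/

noncomputable section

namespace Literature.MathematicalPhysics.QuantumLattice

open Matrix Finset Literature.Probability.LatticeModels GaugedHubbard
open scoped Kronecker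

namespace SpinGauged

/-! ### The link averaging operator -/

section Links

variable {G : Type*} [Fintype G] [DecidableEq G] (L : ℕ)

/-- The link averaging operator `Π_b` of the bond `b`: `(Π_b ψ)(k) = |G|⁻¹ Σ_{h ∈ G} ψ(k[b ↦ h])`,
the orthogonal projector onto the link wave-functions that do not depend on `u_b` (matrix entry
`|G|⁻¹` between configurations agreeing off `b`, `0` otherwise); the electric operator of
`SpinGaugedHubbardTorus` is `E_b = 1 - Π_b` (`electricLink_eq_one_sub_linkAverage`). [folklore] -/
def linkAverage (b : Bond L) : Matrix (Bond L → G) (Bond L → G) ℂ :=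
  of fun k k' => if (∀ b', b' ≠ b → k b' = k' b') then ((Fintype.card G : ℂ))⁻¹ else 0

end Links

/-! ### Gauge transformations -/

section Gauge

variable {G : Type*} [Group G] [Fintype G] [DecidableEq G]

/-- The one-body spin rotation by a site-dependent family of `2 × 2` matrices `u`: block diagonal
in the site, `(orb x σ, orb x' τ) ↦ [x = x'] u_x στ`. [folklore] -/
def spinRotation {Λ : Type*} [DecidableEq Λ] (u : Λ → Matrix (Fin 2) (Fin 2) ℂ) : Matrix (Orb Λ) (Orb Λ) ℂ :=
  of fun p q => if (ofLex p).1 = (ofLex q).1 then u (ofLex p).1 (ofLex p).2 (ofLex q).2 else 0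

variable (ρ : G →* Matrix (Fin 2) (Fin 2) ℂ) (L : ℕ) [NeZero L]

/-- The action of a gauge transformation `η : sites → G` on link configurations:
`u_{(x,i)} ↦ η_x u_{(x,i)} η_{x+eᵢ}⁻¹`. Bietenholz–Wiese (2025) §11.8, eqs. (11.56), (11.64).
[cite: BietenholzWiese2025, §11.8 eq. (11.64)] -/
def gaugeAct (η : FermionTorus 2 L → G) (k : Bond L → G) : Bond L → G :=
  fun b => η b.1 * k b * (η (b.1.shift b.2))⁻¹

/-- The link factor of a gauge transformation: the permutation matrix `|k⟩ ↦ |gaugeAct η k⟩` of the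
group-element basis (left translation on outgoing, inverse right translation on incoming links).
Bietenholz–Wiese (2025) §11.8, eq. (11.64). [folklore] -/
def linkGauge (η : FermionTorus 2 L → G) : Matrix (Bond L → G) (Bond L → G) ℂ :=
  of fun k k' => if k = gaugeAct L η k' then 1 else 0

/-- The fermion factor of a gauge transformation: the second quantisation `Γ` of the one-body spin
rotation `⊕_x ρ(η_x)`. Bratteli–Robinson II §5.2.1 (`Γ(U)`); Bietenholz–Wiese (2025) §11.8.
[folklore] -/
def fermionGauge (η : FermionTorus 2 L → G) :
    Matrix (Finset (Orb (FermionTorus 2 L))) (Finset (Orb (FermionTorus 2 L))) ℂ :=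
  Gamma (spinRotation fun x => ρ (η x))

/-- **The unitary gauge transformation** `W(η) = Γ(⊕_x ρ(η_x)) ⊗ (|k⟩ ↦ |η · k|)` of the coupled
system, for a gauge function `η : sites → G`; the local transformation at `y` by `h` is
`W(Pi.mulSingle y h)`. Bietenholz–Wiese (2025) §11.8, eq. (11.64). [folklore] -/
def gaugeTransform (η : FermionTorus 2 L → G) : Matrix (Index L G) (Index L G) ℂ :=
  fermionGauge ρ L η ⊗ₖ linkGauge L η

/-- The gauge-invariant (Gauss-law) subspace: the joint fixed space of all `W(η)`.
Bietenholz–Wiese (2025) §11.8 (non-Abelian Gauss law `G_x^a |Ψ⟩ = 0`). [folklore] -/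
def gaugeInvariantSubspace : Submodule ℂ (Index L G → ℂ) :=
  ⨅ η : FermionTorus 2 L → G,
    LinearMap.ker (Matrix.toLin' (gaugeTransform ρ L η) - LinearMap.id)

/-- The group average `|G|^{-|Λ|} Σ_η W(η)` (the projector `P` onto the gauge-invariant subspace).
Bietenholz–Wiese (2025) §11.8–11.9 (`P_Q` at `Q = 0`). [folklore] -/
def gaugeAverage : Matrix (Index L G) (Index L G) ℂ :=
  ((Fintype.card (FermionTorus 2 L → G) : ℂ))⁻¹ • ∑ η : FermionTorus 2 L → G, gaugeTransform ρ L η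

end Gauge

end SpinGauged

namespace SpinGauged

/-! ### Algebra of `2 × 2` matrices: the singlet metric, unitarity, class functions -/

section TwoByTwo

/-- `Aᵀ ε A = det A · ε` for every `2 × 2` matrix (`ε = Q8.eps = [[0,1],[-1,0]]` the singlet
metric): the singlet form is invariant exactly under `SL(2)`. [folklore] -/
theorem transpose_mul_eps_mul (A : Matrix (Fin 2) (Fin 2) ℂ) :
    Aᵀ * Q8.eps * A = A.det • Q8.eps := by
  ext i j
  fin_cases i <;> fin_cases j <;>
    simp [Q8.eps, Matrix.mul_apply, Fin.sum_univ_two, Matrix.det_fin_two] <;> ring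

/-- `A ε Aᵀ = det A · ε` for every `2 × 2` matrix. [folklore] -/
theorem mul_eps_mul_transpose (A : Matrix (Fin 2) (Fin 2) ℂ) :
    A * Q8.eps * Aᵀ = A.det • Q8.eps := by
  ext i j
  fin_cases i <;> fin_cases j <;>
    simp [Q8.eps, Matrix.mul_apply, Fin.sum_univ_two, Matrix.det_fin_two] <;> ring

variable {G : Type*} [Group G] (ρ : G →* Matrix (Fin 2) (Fin 2) ℂ)

/-- For a UNITARY representation the adjoint is the inverse: `ρ(u)ᴴ = ρ(u⁻¹)`. [folklore] -/
theorem conjTranspose_rep_eq (hρ : ∀ h : G, ρ h ∈ Matrix.unitaryGroup (Fin 2) ℂ) (u : G) :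
    (ρ u)ᴴ = ρ u⁻¹ := by
  have h := Matrix.mem_unitaryGroup_iff'.1 (hρ u)
  rw [star_eq_conjTranspose] at h
  calc (ρ u)ᴴ = (ρ u)ᴴ * (ρ u * ρ u⁻¹) := by rw [← map_mul, mul_inv_cancel, map_one, Matrix.mul_one]
    _ = ρ u⁻¹ := by rw [← Matrix.mul_assoc, h, Matrix.one_mul]

/-- `ρ(u)ᴴ ρ(u) = 1` for unitary `ρ`. [folklore] -/
theorem conjTranspose_rep_mul_self (hρ : ∀ h : G, ρ h ∈ Matrix.unitaryGroup (Fin 2) ℂ) (u : G) :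
    (ρ u)ᴴ * ρ u = 1 := by
  rw [conjTranspose_rep_eq ρ hρ, ← map_mul, inv_mul_cancel, map_one]

/-- `ρ(u) ρ(u)ᴴ = 1` for unitary `ρ`. [folklore] -/
theorem rep_mul_conjTranspose_self (hρ : ∀ h : G, ρ h ∈ Matrix.unitaryGroup (Fin 2) ℂ) (u : G) :
    ρ u * (ρ u)ᴴ = 1 := by
  rw [conjTranspose_rep_eq ρ hρ, ← map_mul, mul_inv_cancel, map_one]

/-- In `SU(2)`, `Uᴴ = adj U`, hence **the trace of an `SU(2)` matrix is real**:
`star (tr U) = tr U`. [folklore] -/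
theorem star_trace_of_mem_specialUnitaryGroup {U : Matrix (Fin 2) (Fin 2) ℂ}
    (hU : U ∈ Matrix.specialUnitaryGroup (Fin 2) ℂ) : star U.trace = U.trace := by
  obtain ⟨hu, hdet⟩ := Matrix.mem_specialUnitaryGroup_iff.1 hU
  have h1 : star U * U = 1 := Unitary.star_mul_self_of_mem hu
  have hadj : star U = adjugate U := by
    calc star U = star U * (U * adjugate U) := by
            rw [Matrix.mul_adjugate, hdet, one_smul, Matrix.mul_one]
      _ = adjugate U := by rw [← Matrix.mul_assoc, h1, Matrix.one_mul]
  have h := congrArg Matrix.trace hadj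
  rw [Matrix.star_eq_conjTranspose, Matrix.trace_conjTranspose, Matrix.adjugate_fin_two,
    Matrix.trace_fin_two_of] at h
  rw [h, Matrix.trace_fin_two, add_comm]

/-- The hermiticity hypothesis of `isHermitian_spinGaugedHubbardTorusWith` holds for every
`SU(2)`-valued representation: the characters `ρ(h)₀₀ + ρ(h)₁₁` are real. [folklore] -/
theorem star_trace_rep_of_mem (hρ : ∀ h : G, ρ h ∈ Matrix.specialUnitaryGroup (Fin 2) ℂ) (h : G) :
    star (ρ h 0 0 + ρ h 1 1) = ρ h 0 0 + ρ h 1 1 := by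
  rw [← Matrix.trace_fin_two]
  exact star_trace_of_mem_specialUnitaryGroup (hρ h)

/-- The magnetic weight is a class function: `w(v u v⁻¹) = w(u)` (cyclicity of the trace; no
hypothesis on `ρ`). [folklore] -/
theorem plaquetteWeight_conj (u v : G) :
    plaquetteWeight ρ (v * u * v⁻¹) = plaquetteWeight ρ u := by
  rw [plaquetteWeight_eq_trace, plaquetteWeight_eq_trace, map_mul, map_mul, Matrix.trace_mul_cycle,
    ← map_mul, inv_mul_cancel, map_one, Matrix.one_mul]

end TwoByTwo

/-! ### Kronecker products and block-diagonal operators over the link basis -/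

section LinkDiag

variable {F K : Type*} [Fintype F] [Fintype K] [DecidableEq F] [DecidableEq K]

omit [Fintype F] [Fintype K] [DecidableEq F] [DecidableEq K] in
/-- Kronecker products distribute over finite sums (right factor). [folklore] -/
theorem kronecker_sum {ι : Type*} (A : Matrix F F ℂ) (s : Finset ι) (B : ι → Matrix K K ℂ) :
    A ⊗ₖ (∑ i ∈ s, B i) = ∑ i ∈ s, A ⊗ₖ B i := by
  classical
  induction s using Finset.induction_on with
  | empty => simp
  | insert i s hi ih => rw [Finset.sum_insert hi, Finset.sum_insert hi, Matrix.kronecker_add, ih]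

omit [Fintype F] [Fintype K] [DecidableEq F] [DecidableEq K] in
/-- Kronecker products distribute over finite sums (left factor). [folklore] -/
theorem sum_kronecker {ι : Type*} (s : Finset ι) (A : ι → Matrix F F ℂ) (B : Matrix K K ℂ) :
    (∑ i ∈ s, A i) ⊗ₖ B = ∑ i ∈ s, A i ⊗ₖ B := by
  classical
  induction s using Finset.induction_on with
  | empty => simp
  | insert i s hi ih => rw [Finset.sum_insert hi, Finset.sum_insert hi, Matrix.add_kronecker, ih]

omit [Fintype F] [Fintype K] [DecidableEq F] in
/-- The operator `Σ_k S(k) ⊗ |k⟩⟨k|`, block diagonal in the link basis with fermionic blocks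
`S k` ("a fermion operator whose coefficients are functions of the link configuration").
[folklore] -/
def linkDiag (S : K → Matrix F F ℂ) : Matrix (F × K) (F × K) ℂ :=
  of fun a b => if a.2 = b.2 then S a.2 a.1 b.1 else 0

omit [Fintype F] [Fintype K] [DecidableEq F] in
/-- Entries of `linkDiag`. [folklore] -/
@[simp] theorem linkDiag_apply (S : K → Matrix F F ℂ) (a b : F × K) :
    linkDiag S a b = if a.2 = b.2 then S a.2 a.1 b.1 else 0 := rfl

omit [Fintype F] [Fintype K] [DecidableEq F] in
/-- `X ⊗ diag(f) = Σ_k (f k • X) ⊗ |k⟩⟨k|`. [folklore] -/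
theorem kronecker_diagonal_eq_linkDiag (X : Matrix F F ℂ) (f : K → ℂ) :
    X ⊗ₖ diagonal f = linkDiag (fun k => f k • X) := by
  ext ⟨a, k⟩ ⟨b, k'⟩
  simp only [Matrix.kronecker_apply, linkDiag_apply, Matrix.diagonal_apply, Matrix.smul_apply,
    smul_eq_mul]
  split_ifs with h
  · subst h
    ring
  · ring

omit [Fintype F] [Fintype K] [DecidableEq F] in
/-- `X ⊗ 1 = Σ_k X ⊗ |k⟩⟨k|`. [folklore] -/
theorem kronecker_one_eq_linkDiag (X : Matrix F F ℂ) :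
    X ⊗ₖ (1 : Matrix K K ℂ) = linkDiag (fun _ : K => X) := by
  ext ⟨a, k⟩ ⟨b, k'⟩
  simp only [Matrix.kronecker_apply, linkDiag_apply, Matrix.one_apply, mul_ite, mul_one, mul_zero]

omit [Fintype F] [Fintype K] [DecidableEq F] in
/-- `linkDiag` is additive. [folklore] -/
theorem linkDiag_add (S T : K → Matrix F F ℂ) : linkDiag (S + T) = linkDiag S + linkDiag T := by
  ext ⟨a, k⟩ ⟨b, k'⟩
  simp only [linkDiag_apply, Matrix.add_apply, Pi.add_apply]
  split_ifs <;> simp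

omit [Fintype F] [Fintype K] [DecidableEq F] in
/-- `linkDiag` commutes with finite sums. [folklore] -/
theorem linkDiag_sum {ι : Type*} (s : Finset ι) (S : ι → K → Matrix F F ℂ) :
    linkDiag (fun k => ∑ i ∈ s, S i k) = ∑ i ∈ s, linkDiag (S i) := by
  ext ⟨a, k⟩ ⟨b, k'⟩
  simp only [linkDiag_apply, Matrix.sum_apply]
  split_ifs with h
  · rfl
  · simp

omit [Fintype F] [Fintype K] [DecidableEq F] in
/-- `linkDiag` is homogeneous. [folklore] -/
theorem linkDiag_smul (c : ℂ) (S : K → Matrix F F ℂ) : linkDiag (c • S) = c • linkDiag S := by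
  ext ⟨a, k⟩ ⟨b, k'⟩
  simp only [linkDiag_apply, Matrix.smul_apply, Pi.smul_apply, smul_eq_mul]
  split_ifs <;> simp

omit [Fintype F] [Fintype K] [DecidableEq F] in
/-- `linkDiag` and adjoints. [folklore] -/
theorem linkDiag_conjTranspose (S : K → Matrix F F ℂ) :
    (linkDiag S)ᴴ = linkDiag (fun k => (S k)ᴴ) := by
  ext ⟨a, k⟩ ⟨b, k'⟩
  simp only [linkDiag_apply, Matrix.conjTranspose_apply]
  by_cases h : k = k'
  · subst h
    simp
  · rw [if_neg (Ne.symm h), if_neg h, star_zero]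

omit [DecidableEq F] in
/-- `linkDiag` is multiplicative. [folklore] -/
theorem linkDiag_mul (S T : K → Matrix F F ℂ) :
    linkDiag S * linkDiag T = linkDiag (fun k => S k * T k) := by
  ext ⟨a, k⟩ ⟨b, k'⟩
  simp only [Matrix.mul_apply, Fintype.sum_prod_type, linkDiag_apply]
  rw [Finset.sum_comm]
  rw [Finset.sum_eq_single k]
  · simp only [if_true]
    split_ifs with h
    · rfl
    · simp
  · intro j _ hj
    simp [Ne.symm hj]
  · intro h
    exact absurd (Finset.mem_univ k) h

omit [DecidableEq F] in
/-- **Transport of block-diagonal operators by a product transformation**: if `Γ S(k) = S'(e k) Γ`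
for every link configuration `k`, then `(Γ ⊗ P_e) · Σ_k S(k) ⊗ |k⟩⟨k| = (Σ_k S'(k) ⊗ |k⟩⟨k|) · (Γ ⊗ P_e)`
for the permutation matrix `P_e |k⟩ = |e k⟩`. [folklore] -/
theorem kronecker_perm_mul_linkDiag (Γ : Matrix F F ℂ) (e : K → K) (S S' : K → Matrix F F ℂ)
    (h : ∀ k, Γ * S k = S' (e k) * Γ) :
    (Γ ⊗ₖ (of fun k k' => if k = e k' then (1 : ℂ) else 0)) * linkDiag S =
      linkDiag S' * (Γ ⊗ₖ (of fun k k' => if k = e k' then (1 : ℂ) else 0)) := by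
  ext ⟨a, k⟩ ⟨b, k'⟩
  simp only [Matrix.mul_apply, Fintype.sum_prod_type, Matrix.kronecker_apply, linkDiag_apply,
    Matrix.of_apply]
  -- left: Σ_c Σ_j Γ a c [k = e j] [j = k'] S j c b ; right: Σ_c Σ_j [k = j] S' k a c Γ c b [j = e k']
  have hl : ∀ c : F, ∑ j : K, Γ a c * (if k = e j then (1 : ℂ) else 0) *
      (if j = k' then S j c b else 0) = if k = e k' then Γ a c * S k' c b else 0 := by
    intro c
    rw [Finset.sum_eq_single k']
    · simp only [if_true]
      split_ifs <;> simp
    · intro j _ hj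
      rw [if_neg hj, mul_zero]
    · intro hk
      exact absurd (Finset.mem_univ k') hk
  have hr : ∀ c : F, ∑ j : K, (if k = j then S' k a c else 0) *
      (Γ c b * (if j = e k' then (1 : ℂ) else 0)) = if k = e k' then S' k a c * Γ c b else 0 := by
    intro c
    rw [Finset.sum_eq_single k]
    · simp only [if_true]
      split_ifs <;> simp
    · intro j _ hj
      rw [if_neg (Ne.symm hj), zero_mul]
    · intro hk
      exact absurd (Finset.mem_univ k) hk
  simp only [hl, hr]
  split_ifs with hk
  · rw [← Matrix.mul_apply, ← Matrix.mul_apply, hk, h k']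
  · simp

end LinkDiag

/-! ### One-body spin rotations -/

section SpinRotation

/- The extra `[DecidableEq Λ]` makes every lemma polymorphic in the decidability instance used by
`spinRotation` (for `Λ = FermionTorus 2 L` instance search does not return the classical
`LinearOrder.toDecidableEq`, so lemmas stated with the latter would not apply). -/
variable {Λ : Type*} [LinearOrder Λ] [Fintype Λ] [DecidableEq Λ]

omit [LinearOrder Λ] [Fintype Λ] in
/-- Entries of a spin rotation. [folklore] -/
theorem spinRotation_apply (u : Λ → Matrix (Fin 2) (Fin 2) ℂ) (p q : Orb Λ) :
    spinRotation u p q = if (ofLex p).1 = (ofLex q).1 then u (ofLex p).1 (ofLex p).2 (ofLex q).2 else 0 :=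
  rfl

omit [LinearOrder Λ] [Fintype Λ] in
/-- Entries of a spin rotation in the orbital basis. [folklore] -/
@[simp] theorem spinRotation_orb (u : Λ → Matrix (Fin 2) (Fin 2) ℂ) (x x' : Λ) (σ τ : Fin 2) :
    spinRotation u (orb x σ) (orb x' τ) = if x = x' then u x σ τ else 0 := rfl

omit [LinearOrder Λ] [DecidableEq Λ] in
/-- Sums over orbitals are sums over sites and spins. [folklore] -/
theorem sum_orb {M : Type*} [AddCommMonoid M] (f : Orb Λ → M) :
    ∑ p, f p = ∑ x : Λ, ∑ σ : Fin 2, f (orb x σ) := by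
  rw [← Fintype.sum_prod_type', ← (toLex : Λ × Fin 2 ≃ Orb Λ).sum_comp]

omit [LinearOrder Λ] in
/-- Spin rotations compose sitewise. [folklore] -/
theorem spinRotation_mul (u v : Λ → Matrix (Fin 2) (Fin 2) ℂ) :
    spinRotation u * spinRotation v = spinRotation (u * v) := by
  ext p q
  simp only [Matrix.mul_apply, sum_orb, spinRotation_apply, orb, ofLex_toLex, Pi.mul_apply]
  by_cases h : (ofLex p).1 = (ofLex q).1
  · rw [if_pos h, Finset.sum_eq_single (ofLex p).1]
    · simp only [if_true, h, Fin.sum_univ_two]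
    · intro y _ hy
      simp [Ne.symm hy]
    · intro hp
      exact absurd (Finset.mem_univ _) hp
  · rw [if_neg h]
    refine Finset.sum_eq_zero fun y _ => Finset.sum_eq_zero fun α _ => ?_
    by_cases hy : (ofLex p).1 = y
    · subst hy
      rw [if_neg h, mul_zero]
    · rw [if_neg hy, zero_mul]

omit [LinearOrder Λ] [Fintype Λ] in
/-- The trivial spin rotation (for any decidability instance on the orbitals). [folklore] -/
theorem spinRotation_one [DecidableEq (Orb Λ)] :
    spinRotation (1 : Λ → Matrix (Fin 2) (Fin 2) ℂ) = 1 := by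
  ext p q
  rw [spinRotation_apply, Matrix.one_apply, Pi.one_apply]
  have hpq : p = q ↔ (ofLex p).1 = (ofLex q).1 ∧ (ofLex p).2 = (ofLex q).2 := by
    rw [← Prod.ext_iff]
    exact ofLex.injective.eq_iff.symm
  by_cases h : (ofLex p).1 = (ofLex q).1
  · rw [if_pos h, Matrix.one_apply]
    by_cases h2 : (ofLex p).2 = (ofLex q).2
    · rw [if_pos h2, if_pos (hpq.2 ⟨h, h2⟩)]
    · rw [if_neg h2, if_neg (fun h' => h2 (hpq.1 h').2)]
  · rw [if_neg h, if_neg (fun h' => h (hpq.1 h').1)]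

omit [LinearOrder Λ] [Fintype Λ] in
/-- Adjoints of spin rotations are taken sitewise. [folklore] -/
theorem spinRotation_conjTranspose (u : Λ → Matrix (Fin 2) (Fin 2) ℂ) :
    (spinRotation u)ᴴ = spinRotation (fun x => (u x)ᴴ) := by
  ext p q
  rw [Matrix.conjTranspose_apply, spinRotation_apply, spinRotation_apply, Matrix.conjTranspose_apply]
  by_cases h : (ofLex p).1 = (ofLex q).1
  · rw [if_pos h, if_pos h.symm, h]
  · rw [if_neg h, if_neg (Ne.symm h), star_zero]

omit [LinearOrder Λ] in
/-- A sitewise unitary spin rotation is unitary: `(⊕u)ᴴ (⊕u) = 1`. [folklore] -/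
theorem spinRotation_conjTranspose_mul_self [DecidableEq (Orb Λ)]
    {u : Λ → Matrix (Fin 2) (Fin 2) ℂ} (hu : ∀ x, u x ∈ Matrix.unitaryGroup (Fin 2) ℂ) :
    (spinRotation u)ᴴ * spinRotation u = 1 := by
  rw [spinRotation_conjTranspose, spinRotation_mul, ← spinRotation_one]
  congr 1
  funext x
  have h := Matrix.mem_unitaryGroup_iff'.1 (hu x)
  rwa [star_eq_conjTranspose] at h

omit [LinearOrder Λ] in
/-- `(⊕u) (⊕u)ᴴ = 1` for sitewise unitary `u`. [folklore] -/
theorem spinRotation_mul_conjTranspose [DecidableEq (Orb Λ)]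
    {u : Λ → Matrix (Fin 2) (Fin 2) ℂ} (hu : ∀ x, u x ∈ Matrix.unitaryGroup (Fin 2) ℂ) :
    spinRotation u * (spinRotation u)ᴴ = 1 := by
  rw [spinRotation_conjTranspose, spinRotation_mul, ← spinRotation_one]
  congr 1
  funext x
  have h := Matrix.mem_unitaryGroup_iff.1 (hu x)
  rwa [star_eq_conjTranspose] at h

end SpinRotation

/-! ### The gauge group acting on link configurations -/

section GaugeAction

variable {G : Type*} [Group G] [Fintype G] [DecidableEq G]
variable (L : ℕ) [NeZero L]

omit [Fintype G] [DecidableEq G] in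
/-- Components of a gauge-transformed link configuration. [folklore] -/
@[simp] theorem gaugeAct_apply (η : FermionTorus 2 L → G) (k : Bond L → G) (b : Bond L) :
    gaugeAct L η k b = η b.1 * k b * (η (b.1.shift b.2))⁻¹ := rfl

omit [Fintype G] [DecidableEq G] in
/-- The trivial gauge transformation acts trivially. [folklore] -/
@[simp] theorem gaugeAct_one (k : Bond L → G) : gaugeAct L (1 : FermionTorus 2 L → G) k = k := by
  funext b
  simp

omit [Fintype G] [DecidableEq G] in
/-- `gaugeAct` is a left action of the gauge group `G^Λ`. [folklore] -/
theorem gaugeAct_mul (η η' : FermionTorus 2 L → G) (k : Bond L → G) :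
    gaugeAct L (η * η') k = gaugeAct L η (gaugeAct L η' k) := by
  funext b
  simp only [gaugeAct_apply, Pi.mul_apply, _root_.mul_inv_rev, mul_assoc]

omit [Fintype G] [DecidableEq G] in
/-- `η⁻¹` undoes `η`. [folklore] -/
@[simp] theorem gaugeAct_inv_gaugeAct (η : FermionTorus 2 L → G) (k : Bond L → G) :
    gaugeAct L η⁻¹ (gaugeAct L η k) = k := by
  rw [← gaugeAct_mul, inv_mul_cancel, gaugeAct_one]

omit [Fintype G] [DecidableEq G] in
/-- `η` undoes `η⁻¹`. [folklore] -/
@[simp] theorem gaugeAct_gaugeAct_inv (η : FermionTorus 2 L → G) (k : Bond L → G) :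
    gaugeAct L η (gaugeAct L η⁻¹ k) = k := by
  rw [← gaugeAct_mul, mul_inv_cancel, gaugeAct_one]

omit [Fintype G] [DecidableEq G] in
/-- `gaugeAct η` as a permutation of the link configurations. [folklore] -/
def gaugeActEquiv (η : FermionTorus 2 L → G) : (Bond L → G) ≃ (Bond L → G) where
  toFun := gaugeAct L η
  invFun := gaugeAct L η⁻¹
  left_inv k := gaugeAct_inv_gaugeAct L η k
  right_inv k := gaugeAct_gaugeAct_inv L η k

omit [Fintype G] [DecidableEq G] in
/-- `k = η · k'` iff `η⁻¹ · k = k'`. [folklore] -/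
theorem eq_gaugeAct_iff (η : FermionTorus 2 L → G) (k k' : Bond L → G) :
    k = gaugeAct L η k' ↔ gaugeAct L η⁻¹ k = k' := by
  constructor
  · rintro rfl
    exact gaugeAct_inv_gaugeAct L η k'
  · rintro rfl
    exact (gaugeAct_gaugeAct_inv L η k).symm

omit [Fintype G] [DecidableEq G] in
/-- **Gauge covariance of the holonomy**: `hol_x(η · k) = η_x hol_x(k) η_x⁻¹`.
Bietenholz–Wiese (2025) §11.8, eqs. (11.56), (11.62). [folklore] -/
theorem holonomy_gaugeAct (η : FermionTorus 2 L → G) (k : Bond L → G) (x : FermionTorus 2 L) :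
    holonomy L (gaugeAct L η k) x = η x * holonomy L k x * (η x)⁻¹ := by
  simp only [holonomy, gaugeAct_apply, _root_.mul_inv_rev, FermionTorus.shift_shift_comm x 1 0]
  group

omit [Fintype G] in
/-- Entries of the link permutation matrix. [folklore] -/
@[simp] theorem linkGauge_apply (η : FermionTorus 2 L → G) (k k' : Bond L → G) :
    linkGauge L η k k' = if k = gaugeAct L η k' then 1 else 0 := rfl

omit [Fintype G] in
/-- `P(1) = 1`. [folklore] -/
theorem linkGauge_one : linkGauge L (1 : FermionTorus 2 L → G) = 1 := by
  ext k k'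
  rw [linkGauge_apply, gaugeAct_one, Matrix.one_apply]

/-- `P(η η') = P(η) P(η')`: the link factor is a representation of `G^Λ`. [folklore] -/
theorem linkGauge_mul (η η' : FermionTorus 2 L → G) :
    linkGauge L (η * η') = linkGauge L η * linkGauge L η' := by
  ext k k'
  rw [Matrix.mul_apply, Finset.sum_eq_single (gaugeAct L η' k')]
  · simp only [linkGauge_apply, if_true, mul_one, gaugeAct_mul]
  · intro j _ hj
    rw [linkGauge_apply L η' j, if_neg hj, mul_zero]
  · intro h
    exact absurd (Finset.mem_univ _) h

omit [Fintype G] in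
/-- `P(η)ᴴ = P(η⁻¹)`. [folklore] -/
theorem linkGauge_conjTranspose (η : FermionTorus 2 L → G) :
    (linkGauge L η)ᴴ = linkGauge L η⁻¹ := by
  ext k k'
  rw [Matrix.conjTranspose_apply, linkGauge_apply, linkGauge_apply]
  by_cases h : k' = gaugeAct L η k
  · rw [if_pos h, if_pos ((eq_gaugeAct_iff L η k' k).1 h).symm, star_one]
  · rw [if_neg h, if_neg (fun h' => h ((eq_gaugeAct_iff L η k' k).2 h'.symm)), star_zero]

/-- The link factor is unitary: `P(η)ᴴ P(η) = 1`. [folklore] -/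
theorem linkGauge_conjTranspose_mul_self (η : FermionTorus 2 L → G) :
    (linkGauge L η)ᴴ * linkGauge L η = 1 := by
  rw [linkGauge_conjTranspose, ← linkGauge_mul, inv_mul_cancel, linkGauge_one]

/-- `P(η) P(η)ᴴ = 1`. [folklore] -/
theorem linkGauge_mul_conjTranspose (η : FermionTorus 2 L → G) :
    linkGauge L η * (linkGauge L η)ᴴ = 1 := by
  rw [linkGauge_conjTranspose, ← linkGauge_mul, mul_inv_cancel, linkGauge_one]

/-- Multiplication operators transform by composition: `P(η) diag(f) = diag(f ∘ η⁻¹) P(η)`.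
[folklore] -/
theorem linkGauge_mul_diagonal (η : FermionTorus 2 L → G) (f : (Bond L → G) → ℂ) :
    linkGauge L η * diagonal f = diagonal (fun k => f (gaugeAct L η⁻¹ k)) * linkGauge L η := by
  ext k k'
  rw [Matrix.mul_diagonal, Matrix.diagonal_mul, linkGauge_apply]
  split_ifs with h
  · rw [h, gaugeAct_inv_gaugeAct, one_mul, mul_one]
  · rw [zero_mul, mul_zero]

omit [Fintype G] [DecidableEq G] in
/-- Agreement off a bond is gauge invariant. [folklore] -/
theorem forall_gaugeAct_eq_iff (η : FermionTorus 2 L → G) (b : Bond L) (k k' : Bond L → G) :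
    (∀ b', b' ≠ b → gaugeAct L η k b' = k' b') ↔ (∀ b', b' ≠ b → k b' = gaugeAct L η⁻¹ k' b') := by
  refine forall_congr' fun b' => imp_congr_right fun _ => ?_
  simp only [gaugeAct_apply, Pi.inv_apply, inv_inv]
  constructor
  · intro h
    rw [← h]
    group
  · intro h
    rw [h]
    group

/-- **The electric term is gauge invariant**: `P(η) Π_b = Π_b P(η)`. [folklore] -/
theorem linkGauge_mul_linkAverage (η : FermionTorus 2 L → G) (b : Bond L) :
    linkGauge L η * linkAverage L b = linkAverage L b * linkGauge L η := by
  ext k k'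
  rw [Matrix.mul_apply, Matrix.mul_apply, Finset.sum_eq_single (gaugeAct L η⁻¹ k),
    Finset.sum_eq_single (gaugeAct L η k')]
  · simp only [linkGauge_apply, gaugeAct_gaugeAct_inv, if_true, one_mul, mul_one, linkAverage,
      Matrix.of_apply, forall_gaugeAct_eq_iff, inv_inv]
  · intro j _ hj
    rw [linkGauge_apply, if_neg hj, mul_zero]
  · intro h
    exact absurd (Finset.mem_univ _) h
  · intro j _ hj
    rw [linkGauge_apply, if_neg (fun h => hj ((eq_gaugeAct_iff L η k j).1 h).symm), zero_mul]
  · intro h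
    exact absurd (Finset.mem_univ _) h

end GaugeAction

end SpinGauged

namespace SpinGauged

/-! ### Second quantisation of spin rotations: intertwining with `c†`, `c` -/

section Fermion

open RayleighBound

variable {Λ : Type*} [LinearOrder Λ] [Fintype Λ] [DecidableEq Λ]

omit [LinearOrder Λ] [Fintype Λ] [DecidableEq Λ] in
/-- A pure-algebra rearrangement: `Σ_{στ} A_{στ} Σ_{αβ} a_{ασ} b_{βτ} X_{αβ} = Σ_{αβ} (a A bᵀ)_{αβ} X_{αβ}`.
[folklore] -/
theorem smul_sum_rearrange {V : Type*} [AddCommGroup V] [Module ℂ V]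
    (A a b : Matrix (Fin 2) (Fin 2) ℂ) (X : Fin 2 → Fin 2 → V) :
    (∑ σ : Fin 2, ∑ τ : Fin 2,
        (A σ τ • (∑ α : Fin 2, ∑ β : Fin 2, ((a α σ * b β τ) • X α β : V)) : V)) =
      ∑ α : Fin 2, ∑ β : Fin 2, ((a * A * bᵀ) α β • X α β : V) := by
  simp only [Fin.sum_univ_two, Matrix.mul_apply, Matrix.transpose_apply, smul_add, smul_smul]
  module

/-- The spin bilinear `S_{x,x'}(A) = Σ_{σ,τ} A_{στ} c†_{xσ} c_{x'τ}` (`x = x'`, `A = σ^a/2`: the spin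
operators; `A = 1`: the site occupation; `A = ρ(u_b)`: one covariant hopping term). [folklore] -/
def spinBil (x x' : Λ) (A : Matrix (Fin 2) (Fin 2) ℂ) : Matrix (Finset (Orb Λ)) (Finset (Orb Λ)) ℂ :=
  ∑ σ : Fin 2, ∑ τ : Fin 2, A σ τ • (creation (orb x σ) * annihilation (orb x' τ))

/-- The pair bilinear `P_{x,x'}(A) = Σ_{σ,τ} A_{στ} c_{xσ} c_{x'τ}` (`A = ε`: the singlet pair).
[folklore] -/
def pairBil (x x' : Λ) (A : Matrix (Fin 2) (Fin 2) ℂ) : Matrix (Finset (Orb Λ)) (Finset (Orb Λ)) ℂ :=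
  ∑ σ : Fin 2, ∑ τ : Fin 2, A σ τ • (annihilation (orb x σ) * annihilation (orb x' τ))

omit [DecidableEq Λ] in
/-- `S_{x,x'}` is additive in its coefficient matrix. [folklore] -/
theorem spinBil_add (x x' : Λ) (A B : Matrix (Fin 2) (Fin 2) ℂ) :
    spinBil x x' (A + B) = spinBil x x' A + spinBil x x' B := by
  unfold spinBil
  simp only [Fin.sum_univ_two, Matrix.add_apply, add_smul]
  abel

omit [DecidableEq Λ] in
/-- `S_{x,x'}(0) = 0`. [folklore] -/
@[simp] theorem spinBil_zero (x x' : Λ) : spinBil x x' (0 : Matrix (Fin 2) (Fin 2) ℂ) = 0 := by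
  simp only [spinBil, Fin.sum_univ_two, Matrix.zero_apply, zero_smul, add_zero]

omit [DecidableEq Λ] in
/-- `S_{x,x'}` commutes with finite sums of coefficient matrices. [folklore] -/
theorem spinBil_sum {ι : Type*} (x x' : Λ) (s : Finset ι) (A : ι → Matrix (Fin 2) (Fin 2) ℂ) :
    spinBil x x' (∑ i ∈ s, A i) = ∑ i ∈ s, spinBil x x' (A i) := by
  classical
  induction s using Finset.induction_on with
  | empty => simp
  | insert i s hi ih => rw [Finset.sum_insert hi, Finset.sum_insert hi, spinBil_add, ih]

omit [DecidableEq Λ] in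
/-- `P_{x,x'}` is homogeneous in its coefficient matrix. [folklore] -/
theorem pairBil_smul (x x' : Λ) (c : ℂ) (A : Matrix (Fin 2) (Fin 2) ℂ) :
    pairBil x x' (c • A) = c • pairBil x x' A := by
  unfold pairBil
  simp only [Fin.sum_univ_two, Matrix.smul_apply, smul_eq_mul, smul_add, smul_smul]

/-- **`Γ(U) c†_{xσ} = (Σ_α u_x ασ c†_{xα}) Γ(U)`** for the sitewise spin rotation `U = ⊕_x u_x`.
Bratteli–Robinson II §5.2.1 (`Γ(U) a*(f) Γ(U)* = a*(Uf)`). [cite: BratteliRobinsonII1997, §5.2.1] -/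
theorem Gamma_spinRotation_mul_creation (u : Λ → Matrix (Fin 2) (Fin 2) ℂ) (x : Λ) (σ : Fin 2) :
    Gamma (spinRotation u) * creation (orb x σ) =
      (∑ α : Fin 2, u x α σ • creation (orb x α)) * Gamma (spinRotation u) := by
  rw [Gamma_mul_creation]
  congr 1
  unfold create
  rw [sum_orb, Finset.sum_eq_single x]
  · simp only [spinRotation_orb, if_true]
  · intro y _ hy
    simp only [spinRotation_orb, if_neg hy, zero_smul, Finset.sum_const_zero]
  · intro h
    exact absurd (Finset.mem_univ x) h

/-- `Γ(U)ᴴ Γ(U) = 1` for sitewise unitary `u` (any decidability instance on the right).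
Bratteli–Robinson II §5.2.1. [folklore] -/
theorem Gamma_spinRotation_conjTranspose_mul_self [DecidableEq (Finset (Orb Λ))]
    {u : Λ → Matrix (Fin 2) (Fin 2) ℂ} (hu : ∀ x, u x ∈ Matrix.unitaryGroup (Fin 2) ℂ) :
    (Gamma (spinRotation u))ᴴ * Gamma (spinRotation u) = 1 := by
  classical
  rw [← Gamma_conjTranspose, ← Gamma_mul, spinRotation_conjTranspose_mul_self hu]
  convert Gamma_one (ι := Orb Λ)

/-- `Γ(U) Γ(U)ᴴ = 1` for sitewise unitary `u`. [folklore] -/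
theorem Gamma_spinRotation_mul_conjTranspose [DecidableEq (Finset (Orb Λ))]
    {u : Λ → Matrix (Fin 2) (Fin 2) ℂ} (hu : ∀ x, u x ∈ Matrix.unitaryGroup (Fin 2) ℂ) :
    Gamma (spinRotation u) * (Gamma (spinRotation u))ᴴ = 1 := by
  classical
  rw [← Gamma_conjTranspose, ← Gamma_mul, spinRotation_mul_conjTranspose hu]
  convert Gamma_one (ι := Orb Λ)

/-- **`Γ(U) c_{xσ} = (Σ_α conj(u_x ασ) c_{xα}) Γ(U)`** for a sitewise UNITARY spin rotation.
Bratteli–Robinson II §5.2.1. [cite: BratteliRobinsonII1997, §5.2.1] -/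
theorem Gamma_spinRotation_mul_annihilation {u : Λ → Matrix (Fin 2) (Fin 2) ℂ}
    (hu : ∀ x, u x ∈ Matrix.unitaryGroup (Fin 2) ℂ) (x : Λ) (σ : Fin 2) :
    Gamma (spinRotation u) * annihilation (orb x σ) =
      (∑ α : Fin 2, star (u x α σ) • annihilation (orb x α)) * Gamma (spinRotation u) := by
  classical
  set Γ := Gamma (spinRotation u) with hΓ
  set C := ∑ α : Fin 2, star (u x α σ) • annihilation (orb x α) with hC
  have hc := congrArg Matrix.conjTranspose (Gamma_spinRotation_mul_creation u x σ)
  rw [conjTranspose_mul, conjTranspose_mul, conjTranspose_sum] at hc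
  simp only [conjTranspose_smul, creation, conjTranspose_conjTranspose] at hc
  -- hc : annihilation (orb x σ) * Γᴴ = Γᴴ * C
  calc Γ * annihilation (orb x σ)
      = Γ * annihilation (orb x σ) * (Γᴴ * Γ) := by
          rw [Gamma_spinRotation_conjTranspose_mul_self hu, mul_one]
    _ = Γ * (annihilation (orb x σ) * Γᴴ) * Γ := by simp only [mul_assoc]
    _ = Γ * (Γᴴ * C) * Γ := by rw [hc]
    _ = C * Γ := by rw [← mul_assoc Γ Γᴴ C, Gamma_spinRotation_mul_conjTranspose hu, one_mul]

/-- **Transformation law of the spin bilinears**: `Γ(U) S_{x,x'}(A) = S_{x,x'}(u_x A u_{x'}ᴴ) Γ(U)`.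
[folklore] -/
theorem Gamma_spinRotation_mul_spinBil {u : Λ → Matrix (Fin 2) (Fin 2) ℂ}
    (hu : ∀ x, u x ∈ Matrix.unitaryGroup (Fin 2) ℂ) (x x' : Λ) (A : Matrix (Fin 2) (Fin 2) ℂ) :
    Gamma (spinRotation u) * spinBil x x' A =
      spinBil x x' (u x * A * (u x')ᴴ) * Gamma (spinRotation u) := by
  set Γ := Gamma (spinRotation u) with hΓ
  have key : ∀ σ τ : Fin 2, Γ * (creation (orb x σ) * annihilation (orb x' τ)) =
      (∑ α : Fin 2, ∑ β : Fin 2, ((u x α σ * (u x')ᴴᵀ β τ) •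
        (creation (orb x α) * annihilation (orb x' β)) : Matrix (Finset (Orb Λ)) _ ℂ)) * Γ := by
    intro σ τ
    rw [← mul_assoc, Gamma_spinRotation_mul_creation, mul_assoc,
      Gamma_spinRotation_mul_annihilation hu, ← mul_assoc, Finset.sum_mul]
    congr 1
    refine Finset.sum_congr rfl fun α _ => ?_
    rw [Finset.mul_sum]
    refine Finset.sum_congr rfl fun β _ => ?_
    rw [smul_mul_smul_comm, Matrix.transpose_apply, Matrix.conjTranspose_apply]
  have lhs : Γ * spinBil x x' A = (∑ σ : Fin 2, ∑ τ : Fin 2,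
      (A σ τ • (∑ α : Fin 2, ∑ β : Fin 2, ((u x α σ * (u x')ᴴᵀ β τ) •
        (creation (orb x α) * annihilation (orb x' β)) : Matrix (Finset (Orb Λ)) _ ℂ)) :
          Matrix (Finset (Orb Λ)) _ ℂ)) * Γ := by
    unfold spinBil
    rw [Finset.sum_mul, Finset.mul_sum]
    refine Finset.sum_congr rfl fun σ _ => ?_
    rw [Finset.sum_mul, Finset.mul_sum]
    refine Finset.sum_congr rfl fun τ _ => ?_
    rw [Matrix.mul_smul, key, Matrix.smul_mul]
  rw [lhs, smul_sum_rearrange, Matrix.transpose_transpose]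
  rfl

/-- **Transformation law of the pair bilinears**: `Γ(U) P_{x,x'}(A) = P_{x,x'}(ū_x A u_{x'}ᴴ) Γ(U)`
(`ū = (uᴴ)ᵀ` the entrywise conjugate). [folklore] -/
theorem Gamma_spinRotation_mul_pairBil {u : Λ → Matrix (Fin 2) (Fin 2) ℂ}
    (hu : ∀ x, u x ∈ Matrix.unitaryGroup (Fin 2) ℂ) (x x' : Λ) (A : Matrix (Fin 2) (Fin 2) ℂ) :
    Gamma (spinRotation u) * pairBil x x' A =
      pairBil x x' ((u x)ᴴᵀ * A * (u x')ᴴ) * Gamma (spinRotation u) := by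
  set Γ := Gamma (spinRotation u) with hΓ
  have key : ∀ σ τ : Fin 2, Γ * (annihilation (orb x σ) * annihilation (orb x' τ)) =
      (∑ α : Fin 2, ∑ β : Fin 2, (((u x)ᴴᵀ α σ * (u x')ᴴᵀ β τ) •
        (annihilation (orb x α) * annihilation (orb x' β)) : Matrix (Finset (Orb Λ)) _ ℂ)) * Γ := by
    intro σ τ
    rw [← mul_assoc, Gamma_spinRotation_mul_annihilation hu, mul_assoc,
      Gamma_spinRotation_mul_annihilation hu, ← mul_assoc, Finset.sum_mul]
    congr 1
    refine Finset.sum_congr rfl fun α _ => ?_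
    rw [Finset.mul_sum]
    refine Finset.sum_congr rfl fun β _ => ?_
    rw [smul_mul_smul_comm, Matrix.transpose_apply, Matrix.conjTranspose_apply,
      Matrix.transpose_apply, Matrix.conjTranspose_apply]
  have lhs : Γ * pairBil x x' A = (∑ σ : Fin 2, ∑ τ : Fin 2,
      (A σ τ • (∑ α : Fin 2, ∑ β : Fin 2, (((u x)ᴴᵀ α σ * (u x')ᴴᵀ β τ) •
        (annihilation (orb x α) * annihilation (orb x' β)) : Matrix (Finset (Orb Λ)) _ ℂ)) :
          Matrix (Finset (Orb Λ)) _ ℂ)) * Γ := by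
    unfold pairBil
    rw [Finset.sum_mul, Finset.mul_sum]
    refine Finset.sum_congr rfl fun σ _ => ?_
    rw [Finset.sum_mul, Finset.mul_sum]
    refine Finset.sum_congr rfl fun τ _ => ?_
    rw [Matrix.mul_smul, key, Matrix.smul_mul]
  rw [lhs, smul_sum_rearrange, Matrix.transpose_transpose]
  rfl

omit [DecidableEq Λ] in
/-- The site occupation `N_x = n_{x↑} + n_{x↓}` is the spin bilinear `S_{x,x}(1)`. [folklore] -/
theorem spinBil_one (x : Λ) :
    spinBil x x (1 : Matrix (Fin 2) (Fin 2) ℂ) = numberOp x 0 + numberOp x 1 := by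
  simp [spinBil, Fin.sum_univ_two, Matrix.one_apply, numberOp]

/-- The site occupation is invariant under spin rotations: `Γ(U) N_x = N_x Γ(U)`. [folklore] -/
theorem Gamma_spinRotation_mul_siteNumber {u : Λ → Matrix (Fin 2) (Fin 2) ℂ}
    (hu : ∀ x, u x ∈ Matrix.unitaryGroup (Fin 2) ℂ) (x : Λ) :
    Gamma (spinRotation u) * (numberOp x 0 + numberOp x 1) =
      (numberOp x 0 + numberOp x 1) * Gamma (spinRotation u) := by
  rw [← spinBil_one, Gamma_spinRotation_mul_spinBil hu, Matrix.mul_one]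
  have h : u x * (u x)ᴴ = 1 := by
    have := Matrix.mem_unitaryGroup_iff.1 (hu x)
    rwa [star_eq_conjTranspose] at this
  rw [h]

omit [DecidableEq Λ] in
/-- `n_{x↑} n_{x↓} = ½ (N_x² - N_x)`. [folklore] -/
theorem numberOp_mul_numberOp_eq (x : Λ) :
    numberOp x 0 * numberOp x 1 =
      (1 / 2 : ℂ) • ((numberOp x 0 + numberOp x 1) * (numberOp x 0 + numberOp x 1) -
        (numberOp x 0 + numberOp x 1)) := by
  have h0 : numberOp x 0 * numberOp x 0 = numberOp x 0 := (numberAt_idempotent (orb x 0)).eq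
  have h1 : numberOp x 1 * numberOp x 1 = numberOp x 1 := (numberAt_idempotent (orb x 1)).eq
  have hc : numberOp x 1 * numberOp x 0 = numberOp x 0 * numberOp x 1 :=
    (numberAt_commute (orb x 1) (orb x 0)).eq
  rw [add_mul, mul_add, mul_add, h0, h1, hc]
  module

/-- **The Hubbard interaction is invariant under spin rotations**: `Γ(U) n_{x↑}n_{x↓} = n_{x↑}n_{x↓} Γ(U)`.
[folklore] -/
theorem Gamma_spinRotation_mul_numberOp_mul_numberOp {u : Λ → Matrix (Fin 2) (Fin 2) ℂ}
    (hu : ∀ x, u x ∈ Matrix.unitaryGroup (Fin 2) ℂ) (x : Λ) :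
    Gamma (spinRotation u) * (numberOp x 0 * numberOp x 1) =
      (numberOp x 0 * numberOp x 1) * Gamma (spinRotation u) := by
  have h := Gamma_spinRotation_mul_siteNumber hu x
  rw [numberOp_mul_numberOp_eq, Matrix.mul_smul, Matrix.smul_mul, Matrix.mul_sub, Matrix.sub_mul,
    ← mul_assoc, h, mul_assoc, h, ← mul_assoc]

end Fermion

/-! ### The gauge transformations form a unitary representation of `G^Λ` -/

section GaugeRep

variable {G : Type*} [Group G] [Fintype G] [DecidableEq G]
variable (ρ : G →* Matrix (Fin 2) (Fin 2) ℂ) (L : ℕ) [NeZero L]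

omit [Fintype G] [DecidableEq G] [NeZero L] in
/-- `Γ(η η') = Γ(η) Γ(η')`. Dereziński–Gérard Prop. 3.23 (functoriality of `Γ`). [folklore] -/
theorem fermionGauge_mul (η η' : FermionTorus 2 L → G) :
    fermionGauge ρ L (η * η') = fermionGauge ρ L η * fermionGauge ρ L η' := by
  unfold fermionGauge
  rw [← Gamma_mul, spinRotation_mul]
  congr 2
  funext x
  simp only [Pi.mul_apply, map_mul]

omit [Fintype G] [DecidableEq G] [NeZero L] in
/-- `Γ(η)ᴴ = Γ(η⁻¹)` for a unitary representation. [folklore] -/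
theorem fermionGauge_conjTranspose (hρ : ∀ h : G, ρ h ∈ Matrix.unitaryGroup (Fin 2) ℂ)
    (η : FermionTorus 2 L → G) :
    (fermionGauge ρ L η)ᴴ = fermionGauge ρ L η⁻¹ := by
  unfold fermionGauge
  rw [← Gamma_conjTranspose, spinRotation_conjTranspose]
  congr 2
  funext x
  simp only [Pi.inv_apply, conjTranspose_rep_eq ρ hρ]

omit [Fintype G] [DecidableEq G] [NeZero L] in
/-- `Γ(η)ᴴ Γ(η) = 1`. [folklore] -/
theorem fermionGauge_conjTranspose_mul_self (hρ : ∀ h : G, ρ h ∈ Matrix.unitaryGroup (Fin 2) ℂ)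
    (η : FermionTorus 2 L → G) :
    (fermionGauge ρ L η)ᴴ * fermionGauge ρ L η = 1 :=
  Gamma_spinRotation_conjTranspose_mul_self (fun x => hρ (η x))

omit [Fintype G] [DecidableEq G] [NeZero L] in
/-- `Γ(η) Γ(η)ᴴ = 1`. [folklore] -/
theorem fermionGauge_mul_conjTranspose (hρ : ∀ h : G, ρ h ∈ Matrix.unitaryGroup (Fin 2) ℂ)
    (η : FermionTorus 2 L → G) :
    fermionGauge ρ L η * (fermionGauge ρ L η)ᴴ = 1 :=
  Gamma_spinRotation_mul_conjTranspose (fun x => hρ (η x))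

omit [Fintype G] [DecidableEq G] [NeZero L] in
/-- `Γ(1) = 1`. [folklore] -/
theorem fermionGauge_one (hρ : ∀ h : G, ρ h ∈ Matrix.unitaryGroup (Fin 2) ℂ) :
    fermionGauge ρ L (1 : FermionTorus 2 L → G) = 1 := by
  rw [← one_mul (fermionGauge ρ L 1), ← fermionGauge_conjTranspose_mul_self ρ L hρ 1, mul_assoc,
    ← fermionGauge_mul, mul_one, fermionGauge_conjTranspose ρ L hρ, inv_one]

/-- **`W(η η') = W(η) W(η')`**: the gauge transformations represent the gauge group `G^Λ`.
Bietenholz–Wiese (2025) §11.8, eq. (11.64). [folklore] -/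
theorem gaugeTransform_mul (η η' : FermionTorus 2 L → G) :
    gaugeTransform ρ L (η * η') = gaugeTransform ρ L η * gaugeTransform ρ L η' := by
  unfold gaugeTransform
  rw [fermionGauge_mul, linkGauge_mul, Matrix.mul_kronecker_mul]

omit [Fintype G] in
/-- `W(η)ᴴ = W(η⁻¹)`. [folklore] -/
theorem gaugeTransform_conjTranspose (hρ : ∀ h : G, ρ h ∈ Matrix.unitaryGroup (Fin 2) ℂ)
    (η : FermionTorus 2 L → G) :
    (gaugeTransform ρ L η)ᴴ = gaugeTransform ρ L η⁻¹ := by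
  unfold gaugeTransform
  rw [Matrix.conjTranspose_kronecker, fermionGauge_conjTranspose ρ L hρ, linkGauge_conjTranspose]

/-- **The gauge transformations are unitary**: `W(η)ᴴ W(η) = 1`. [folklore] -/
theorem gaugeTransform_conjTranspose_mul_self (hρ : ∀ h : G, ρ h ∈ Matrix.unitaryGroup (Fin 2) ℂ)
    (η : FermionTorus 2 L → G) :
    (gaugeTransform ρ L η)ᴴ * gaugeTransform ρ L η = 1 := by
  unfold gaugeTransform
  rw [Matrix.conjTranspose_kronecker, ← Matrix.mul_kronecker_mul,
    fermionGauge_conjTranspose_mul_self ρ L hρ, linkGauge_conjTranspose_mul_self,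
    Matrix.one_kronecker_one]

/-- `W(η) W(η)ᴴ = 1`. [folklore] -/
theorem gaugeTransform_mul_conjTranspose (hρ : ∀ h : G, ρ h ∈ Matrix.unitaryGroup (Fin 2) ℂ)
    (η : FermionTorus 2 L → G) :
    gaugeTransform ρ L η * (gaugeTransform ρ L η)ᴴ = 1 := by
  unfold gaugeTransform
  rw [Matrix.conjTranspose_kronecker, ← Matrix.mul_kronecker_mul,
    fermionGauge_mul_conjTranspose ρ L hρ, linkGauge_mul_conjTranspose, Matrix.one_kronecker_one]

/-- `W(1) = 1`. [folklore] -/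
theorem gaugeTransform_one (hρ : ∀ h : G, ρ h ∈ Matrix.unitaryGroup (Fin 2) ℂ) :
    gaugeTransform ρ L (1 : FermionTorus 2 L → G) = 1 := by
  rw [← one_mul (gaugeTransform ρ L 1), ← gaugeTransform_conjTranspose_mul_self ρ L hρ 1, mul_assoc,
    ← gaugeTransform_mul, mul_one, gaugeTransform_conjTranspose ρ L hρ, inv_one]

/-- `W(η)` is unitary. [folklore] -/
theorem gaugeTransform_mem_unitaryGroup (hρ : ∀ h : G, ρ h ∈ Matrix.unitaryGroup (Fin 2) ℂ)
    (η : FermionTorus 2 L → G) :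
    gaugeTransform ρ L η ∈ Matrix.unitaryGroup (Index L G) ℂ := by
  rw [Matrix.mem_unitaryGroup_iff, star_eq_conjTranspose]
  exact gaugeTransform_mul_conjTranspose ρ L hρ η

/-- Transport of block-diagonal operators by `W(η)`: if `Γ(η) S(k) = S'(η · k) Γ(η)` for all `k`
then `W(η) (Σ_k S(k) ⊗ |k⟩⟨k|) = (Σ_k S'(k) ⊗ |k⟩⟨k|) W(η)`. [folklore] -/
theorem gaugeTransform_mul_linkDiag (η : FermionTorus 2 L → G)
    (S S' : (Bond L → G) → Matrix (Finset (Orb (FermionTorus 2 L))) (Finset (Orb (FermionTorus 2 L))) ℂ)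
    (h : ∀ k, fermionGauge ρ L η * S k = S' (gaugeAct L η k) * fermionGauge ρ L η) :
    gaugeTransform ρ L η * linkDiag S = linkDiag S' * gaugeTransform ρ L η :=
  kronecker_perm_mul_linkDiag _ (gaugeAct L η) S S' h

/-- `W(η)ᴴ (X ⊗ 1) W(η) = (Γ(η)ᴴ X Γ(η)) ⊗ 1` for a purely fermionic operator `X`. [folklore] -/
theorem conj_gaugeTransform_kronecker_one (η : FermionTorus 2 L → G)
    (X : Matrix (Finset (Orb (FermionTorus 2 L))) (Finset (Orb (FermionTorus 2 L))) ℂ) :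
    (gaugeTransform ρ L η)ᴴ * (X ⊗ₖ (1 : Matrix (Bond L → G) (Bond L → G) ℂ)) *
        gaugeTransform ρ L η =
      ((fermionGauge ρ L η)ᴴ * X * fermionGauge ρ L η) ⊗ₖ (1 : Matrix (Bond L → G) _ ℂ) := by
  unfold gaugeTransform
  rw [Matrix.conjTranspose_kronecker, ← Matrix.mul_kronecker_mul, ← Matrix.mul_kronecker_mul,
    Matrix.mul_one, linkGauge_conjTranspose_mul_self]

end GaugeRep

/-! ### Gauge invariance of the Hamiltonian and of the pair field -/

section Invariance

variable {G : Type*} [Group G] [Fintype G] [DecidableEq G]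
variable (ρ : G →* Matrix (Fin 2) (Fin 2) ℂ) (L : ℕ) [NeZero L]

omit [Fintype G] in
/-- The covariant hopping of `SpinGaugedHubbardTorus` as a block-diagonal operator over the link
basis: `T = Σ_k (Σ_b S_b(ρ(k_b))) ⊗ |k⟩⟨k|`. [folklore] -/
theorem hop_eq_linkDiag :
    hop ρ L = linkDiag (fun k => ∑ b : Bond L, spinBil b.1 (b.1.shift b.2) (ρ (k b))) := by
  unfold hop spinBil
  simp only [kronecker_diagonal_eq_linkDiag, ← linkDiag_sum]

omit [Fintype G] in
/-- The transported pair field of `SpinGaugedHubbardTorus` as a block-diagonal operator over the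
link basis: `Δ_d^g = Σ_k (Σ_b g_d(b) P_b(ε ρ(k_b))) ⊗ |k⟩⟨k|`. [folklore] -/
theorem spinGaugedPairFieldWith_eq_linkDiag :
    spinGaugedPairFieldWith ρ L = linkDiag (fun k => ∑ b : Bond L,
      (if b.2 = 0 then (1 : ℂ) else -1) • pairBil b.1 (b.1.shift b.2) (Q8.eps * ρ (k b))) := by
  have hb : ∀ b : Bond L, (∑ σ : Fin 2, ∑ τ : Fin 2,
      (annihilation (orb b.1 σ) * annihilation (orb (b.1.shift b.2) τ)) ⊗ₖ
        diagonal (fun k : Bond L → G => epsRep ρ (k b) σ τ)) =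
      linkDiag (fun k => pairBil b.1 (b.1.shift b.2) (Q8.eps * ρ (k b))) := by
    intro b
    unfold pairBil
    simp only [epsRep_eq_eps_mul, kronecker_diagonal_eq_linkDiag, ← linkDiag_sum]
  unfold spinGaugedPairFieldWith
  simp only [hb, ← linkDiag_smul, ← linkDiag_sum]
  rfl

/-- **The covariant hopping is gauge invariant**: `W(η) T = T W(η)` for a unitary `ρ`; the spin
rotation `ρ(η_x) ρ(u_b) ρ(η_{x+eᵢ})⁻¹` of the hopping coefficient is exactly compensated by the
transformation `u_b ↦ η_x u_b η_{x+eᵢ}⁻¹` of the link. Kogut–Susskind (1975); Bietenholz–Wiese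
(2025) §11.8, eqs. (11.63)–(11.64). [folklore] -/
theorem gaugeTransform_mul_hop (hρ : ∀ h : G, ρ h ∈ Matrix.unitaryGroup (Fin 2) ℂ)
    (η : FermionTorus 2 L → G) :
    gaugeTransform ρ L η * hop ρ L = hop ρ L * gaugeTransform ρ L η := by
  rw [hop_eq_linkDiag]
  refine gaugeTransform_mul_linkDiag ρ L η _ _ fun k => ?_
  rw [Finset.mul_sum, Finset.sum_mul]
  refine Finset.sum_congr rfl fun b _ => ?_
  rw [fermionGauge, Gamma_spinRotation_mul_spinBil (fun x => hρ (η x))]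
  congr 2
  rw [conjTranspose_rep_eq ρ hρ, gaugeAct_apply, map_mul, map_mul]

omit [Fintype G] [DecidableEq G] in
/-- `(ρᴴ)ᵀ ε = ε ρ` for `ρ` unitary of determinant one (from `Aᵀ ε A = det A · ε`). [folklore] -/
theorem conjTranspose_transpose_mul_eps (hρ : ∀ h : G, ρ h ∈ Matrix.unitaryGroup (Fin 2) ℂ)
    (hdet : ∀ h : G, (ρ h).det = 1) (u : G) :
    (ρ u)ᴴᵀ * Q8.eps = Q8.eps * ρ u := by
  have h := transpose_mul_eps_mul (ρ u)ᴴ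
  rw [Matrix.det_conjTranspose, hdet, star_one, one_smul] at h
  calc (ρ u)ᴴᵀ * Q8.eps
      = (ρ u)ᴴᵀ * Q8.eps * ((ρ u)ᴴ * ρ u) := by
        rw [conjTranspose_rep_mul_self ρ hρ, Matrix.mul_one]
    _ = Q8.eps * ρ u := by rw [← Matrix.mul_assoc, h]

/-- **The transported singlet pair field is gauge invariant**: `W(η) Δ_d^g = Δ_d^g W(η)` for a
unitary `ρ` of determinant one (the singlet metric `ε` is `SU(2)`-invariant, `ρᵀ ε ρ = ε`).
Fradkin–Shenker (1979) (gauge-invariant composites). [folklore] -/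
theorem gaugeTransform_mul_spinGaugedPairFieldWith (hρ : ∀ h : G, ρ h ∈ Matrix.unitaryGroup (Fin 2) ℂ)
    (hdet : ∀ h : G, (ρ h).det = 1) (η : FermionTorus 2 L → G) :
    gaugeTransform ρ L η * spinGaugedPairFieldWith ρ L =
      spinGaugedPairFieldWith ρ L * gaugeTransform ρ L η := by
  rw [spinGaugedPairFieldWith_eq_linkDiag]
  refine gaugeTransform_mul_linkDiag ρ L η _ _ fun k => ?_
  rw [Finset.mul_sum, Finset.sum_mul]
  refine Finset.sum_congr rfl fun b _ => ?_
  rw [Matrix.mul_smul, Matrix.smul_mul, fermionGauge, Gamma_spinRotation_mul_pairBil (fun x => hρ (η x))]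
  congr 3
  rw [← Matrix.mul_assoc, conjTranspose_transpose_mul_eps ρ hρ hdet, conjTranspose_rep_eq ρ hρ,
    gaugeAct_apply, map_mul, map_mul, Matrix.mul_assoc, Matrix.mul_assoc, Matrix.mul_assoc]

/-- The Hubbard interaction `Σ_x n_{x↑}n_{x↓} ⊗ 1` is gauge invariant. [folklore] -/
theorem gaugeTransform_mul_interaction (hρ : ∀ h : G, ρ h ∈ Matrix.unitaryGroup (Fin 2) ℂ)
    (η : FermionTorus 2 L → G) :
    gaugeTransform ρ L η * ((∑ x : FermionTorus 2 L, numberOp x 0 * numberOp x 1) ⊗ₖ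
        (1 : Matrix (Bond L → G) (Bond L → G) ℂ)) =
      ((∑ x : FermionTorus 2 L, numberOp x 0 * numberOp x 1) ⊗ₖ
        (1 : Matrix (Bond L → G) (Bond L → G) ℂ)) * gaugeTransform ρ L η := by
  rw [kronecker_one_eq_linkDiag]
  refine gaugeTransform_mul_linkDiag ρ L η _ _ fun k => ?_
  rw [Finset.mul_sum, Finset.sum_mul]
  refine Finset.sum_congr rfl fun x _ => ?_
  exact Gamma_spinRotation_mul_numberOp_mul_numberOp (fun x => hρ (η x)) x

omit [Group G] [NeZero L] in
/-- **`E_b = 1 - Π_b`**: the electric operator of `SpinGaugedHubbardTorus` is the complementary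
projector of the link average. [folklore] -/
theorem electricLink_eq_one_sub_linkAverage (b : Bond L) :
    (electricLink L b : Matrix (Bond L → G) _ ℂ) = 1 - linkAverage L b := by
  ext k k'
  rw [electricLink_apply, Matrix.sub_apply, linkAverage, Matrix.of_apply, Matrix.one_apply, one_div]
  have hiff : (∀ b', b' ≠ b → k b' = k' b') ↔ k' = Function.update k b (k' b) := by
    rw [eq_update_iff]
    exact forall_congr' fun b' => imp_congr_right fun _ => eq_comm
  by_cases h : ∀ b', b' ≠ b → k b' = k' b'
  · rw [if_pos h, if_pos (hiff.1 h)]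
    by_cases hb : k b = k' b
    · have : k = k' := funext fun b' => by
        by_cases hb' : b' = b
        · subst hb'; exact hb
        · exact h b' hb'
      rw [if_pos this, if_pos hb]
    · rw [if_neg (fun hk => hb (congrFun hk b)), if_neg hb]
  · rw [if_neg h, if_neg (fun h' => h (hiff.2 h')), if_neg, sub_zero]
    rintro rfl
    exact h fun _ _ => rfl

/-- The electric energy commutes with the link permutations: `P(η) Σ_b E_b = (Σ_b E_b) P(η)`.
[folklore] -/
theorem linkGauge_mul_electric (η : FermionTorus 2 L → G) :
    linkGauge L η * electric L = electric L * linkGauge L η := by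
  unfold electric
  rw [Finset.mul_sum, Finset.sum_mul]
  refine Finset.sum_congr rfl fun b _ => ?_
  rw [electricLink_eq_one_sub_linkAverage, Matrix.mul_sub, Matrix.sub_mul, Matrix.mul_one,
    Matrix.one_mul, linkGauge_mul_linkAverage]

/-- The electric energy `1 ⊗ Σ_b E_b` is gauge invariant. [folklore] -/
theorem gaugeTransform_mul_electric (η : FermionTorus 2 L → G) :
    gaugeTransform ρ L η * ((1 : Matrix (Finset (Orb (FermionTorus 2 L))) _ ℂ) ⊗ₖ electric L) =
      ((1 : Matrix (Finset (Orb (FermionTorus 2 L))) _ ℂ) ⊗ₖ electric L) * gaugeTransform ρ L η := by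
  unfold gaugeTransform
  rw [← Matrix.mul_kronecker_mul, ← Matrix.mul_kronecker_mul, Matrix.mul_one, Matrix.one_mul,
    linkGauge_mul_electric]

omit [Fintype G] [DecidableEq G] in
/-- The magnetic energy density is a gauge-invariant function of the links:
`Σ_p w(hol_p(η · k)) = Σ_p w(hol_p(k))`. [folklore] -/
theorem magneticWeight_gaugeAct (η : FermionTorus 2 L → G) (k : Bond L → G) :
    (∑ x : FermionTorus 2 L, plaquetteWeight ρ (holonomy L (gaugeAct L η k) x)) =
      ∑ x : FermionTorus 2 L, plaquetteWeight ρ (holonomy L k x) := by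
  refine Finset.sum_congr rfl fun x _ => ?_
  rw [holonomy_gaugeAct, plaquetteWeight_conj]

/-- The magnetic energy commutes with the link permutations. [folklore] -/
theorem linkGauge_mul_magnetic (η : FermionTorus 2 L → G) :
    linkGauge L η * magnetic ρ L = magnetic ρ L * linkGauge L η := by
  have hf : (fun k : Bond L → G => ∑ x : FermionTorus 2 L,
      plaquetteWeight ρ (holonomy L (gaugeAct L η⁻¹ k) x)) =
      fun k => ∑ x : FermionTorus 2 L, plaquetteWeight ρ (holonomy L k x) :=
    funext fun k => magneticWeight_gaugeAct ρ L η⁻¹ k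
  unfold magnetic
  rw [linkGauge_mul_diagonal, hf]

/-- The magnetic energy `1 ⊗ Σ_p (1 - ½ tr ρ(hol_p))` is gauge invariant. [folklore] -/
theorem gaugeTransform_mul_magnetic (η : FermionTorus 2 L → G) :
    gaugeTransform ρ L η * ((1 : Matrix (Finset (Orb (FermionTorus 2 L))) _ ℂ) ⊗ₖ magnetic ρ L) =
      ((1 : Matrix (Finset (Orb (FermionTorus 2 L))) _ ℂ) ⊗ₖ magnetic ρ L) * gaugeTransform ρ L η := by
  unfold gaugeTransform
  rw [← Matrix.mul_kronecker_mul, ← Matrix.mul_kronecker_mul, Matrix.mul_one, Matrix.one_mul,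
    linkGauge_mul_magnetic]

/-- **GAUGE INVARIANCE OF THE SPIN-GAUGED HUBBARD TORUS**: `[W(η), H] = 0` for every gauge
transformation `η : sites → G` (in particular the local ones `η = Pi.mulSingle y h`) and every
unitary representation `ρ`. Kogut–Susskind (1975); Bietenholz–Wiese (2025) §11.8, eq. (11.63)
(`[H, G_x^a] = 0`). [cite: BietenholzWiese2025, §11.8 eq. (11.63)] -/
theorem commute_gaugeTransform_spinGaugedHubbardTorusWith
    (hρ : ∀ h : G, ρ h ∈ Matrix.unitaryGroup (Fin 2) ℂ) (η : FermionTorus 2 L → G) (U gE gB : ℝ) :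
    Commute (gaugeTransform ρ L η) (spinGaugedHubbardTorusWith ρ L U gE gB) := by
  have hhop : Commute (gaugeTransform ρ L η) (hop ρ L) := gaugeTransform_mul_hop ρ L hρ η
  have hhop' : Commute (gaugeTransform ρ L η) (hop ρ L)ᴴ := by
    have h := gaugeTransform_mul_hop ρ L hρ η⁻¹
    have h' := congrArg Matrix.conjTranspose h
    rw [Matrix.conjTranspose_mul, Matrix.conjTranspose_mul, gaugeTransform_conjTranspose ρ L hρ,
      inv_inv] at h'
    exact h'.symm
  have hint : Commute (gaugeTransform ρ L η) ((∑ x : FermionTorus 2 L, numberOp x 0 * numberOp x 1) ⊗ₖ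
      (1 : Matrix (Bond L → G) (Bond L → G) ℂ)) := gaugeTransform_mul_interaction ρ L hρ η
  have hel : Commute (gaugeTransform ρ L η)
      ((1 : Matrix (Finset (Orb (FermionTorus 2 L))) _ ℂ) ⊗ₖ electric L) :=
    gaugeTransform_mul_electric ρ L η
  have hmag : Commute (gaugeTransform ρ L η)
      ((1 : Matrix (Finset (Orb (FermionTorus 2 L))) _ ℂ) ⊗ₖ magnetic ρ L) :=
    gaugeTransform_mul_magnetic ρ L η
  unfold spinGaugedHubbardTorusWith
  refine Commute.add_right (Commute.add_right (Commute.add_right ?_ ?_) ?_) ?_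
  · exact (hhop.add_right hhop').neg_right
  · exact hint.smul_right _
  · exact hel.smul_right _
  · exact hmag.smul_right _

/-- **Gauge invariance of `H_g(L, U)`** (the `Q₈`-spin-gauged Hubbard torus of route
ColourTheSpin). Kogut–Susskind (1975). [folklore] -/
theorem commute_gaugeTransform_spinGaugedHubbardTorus (η : FermionTorus 2 L → Q8) (U g : ℝ) :
    Commute (gaugeTransform Q8.rep L η) (spinGaugedHubbardTorus L U g) :=
  commute_gaugeTransform_spinGaugedHubbardTorusWith Q8.rep L Q8.rep_mem_unitaryGroup η U _ _

/-- Gauge invariance of the transported pair field, as a `Commute` statement. [folklore] -/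
theorem commute_gaugeTransform_spinGaugedPairFieldWith
    (hρ : ∀ h : G, ρ h ∈ Matrix.unitaryGroup (Fin 2) ℂ) (hdet : ∀ h : G, (ρ h).det = 1)
    (η : FermionTorus 2 L → G) :
    Commute (gaugeTransform ρ L η) (spinGaugedPairFieldWith ρ L) :=
  gaugeTransform_mul_spinGaugedPairFieldWith ρ L hρ hdet η

/-- **The pair order observable `Δ_d^g† Δ_d^g` is gauge invariant.** [folklore] -/
theorem commute_gaugeTransform_pairOrder
    (hρ : ∀ h : G, ρ h ∈ Matrix.unitaryGroup (Fin 2) ℂ) (hdet : ∀ h : G, (ρ h).det = 1)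
    (η : FermionTorus 2 L → G) :
    Commute (gaugeTransform ρ L η) ((spinGaugedPairFieldWith ρ L)ᴴ * spinGaugedPairFieldWith ρ L) := by
  have h1 : Commute (gaugeTransform ρ L η) (spinGaugedPairFieldWith ρ L) :=
    gaugeTransform_mul_spinGaugedPairFieldWith ρ L hρ hdet η
  have h2 : Commute (gaugeTransform ρ L η) (spinGaugedPairFieldWith ρ L)ᴴ := by
    have h := gaugeTransform_mul_spinGaugedPairFieldWith ρ L hρ hdet η⁻¹
    have h' := congrArg Matrix.conjTranspose h
    rw [Matrix.conjTranspose_mul, Matrix.conjTranspose_mul, gaugeTransform_conjTranspose ρ L hρ,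
      inv_inv] at h'
    exact h'.symm
  exact h2.mul_right h1

/-- Gauge invariance of the `Q₈`-transported `B₁g` pair field `Δ_d^g` of route ColourTheSpin.
[folklore] -/
theorem commute_gaugeTransform_spinGaugedPairField (η : FermionTorus 2 L → Q8) :
    Commute (gaugeTransform Q8.rep L η) (spinGaugedPairField L) :=
  commute_gaugeTransform_spinGaugedPairFieldWith Q8.rep L Q8.rep_mem_unitaryGroup Q8.det_rep η

/-- Gauge invariance of the `Q₈` pair order observable `Δ_d^g† Δ_d^g` of route ColourTheSpin.
[folklore] -/
theorem commute_gaugeTransform_spinGaugedPairField_pairOrder (η : FermionTorus 2 L → Q8) :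
    Commute (gaugeTransform Q8.rep L η) ((spinGaugedPairField L)ᴴ * spinGaugedPairField L) :=
  commute_gaugeTransform_pairOrder Q8.rep L Q8.rep_mem_unitaryGroup Q8.det_rep η

end Invariance

/-! ### The electric operator is a projector -/

section Projector

variable {G : Type*} [Fintype G] [DecidableEq G] (L : ℕ)

/-- The link averaging operator is Hermitian (real symmetric). [folklore] -/
theorem linkAverage_isHermitian (b : Bond L) : (linkAverage L b : Matrix (Bond L → G) _ ℂ).IsHermitian := by
  ext k k'
  simp only [Matrix.conjTranspose_apply, linkAverage, Matrix.of_apply]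
  have hsymm : (∀ b', b' ≠ b → k' b' = k b') ↔ (∀ b', b' ≠ b → k b' = k' b') :=
    forall_congr' fun b' => imp_congr_right fun _ => eq_comm
  by_cases h : ∀ b', b' ≠ b → k b' = k' b'
  · rw [if_pos h, if_pos (hsymm.2 h), star_inv₀, star_natCast]
  · rw [if_neg h, if_neg (fun h' => h (hsymm.1 h')), star_zero]

variable [Nonempty G]

/-- The link average `Π_b` is idempotent. [folklore] -/
theorem linkAverage_mul_self (b : Bond L) :
    (linkAverage L b : Matrix (Bond L → G) _ ℂ) * linkAverage L b = linkAverage L b := by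
  ext k k'
  rw [Matrix.mul_apply]
  simp only [linkAverage, Matrix.of_apply]
  by_cases h : ∀ b', b' ≠ b → k b' = k' b'
  · rw [if_pos h]
    -- the summand is nonzero exactly on the |G| configurations `Function.update k b g`
    have hS : ∀ j : Bond L → G, ((if ∀ b', b' ≠ b → k b' = j b' then ((Fintype.card G : ℂ))⁻¹ else 0) *
        (if ∀ b', b' ≠ b → j b' = k' b' then ((Fintype.card G : ℂ))⁻¹ else 0)) =
        if j ∈ Finset.univ.image (fun g : G => Function.update k b g) then
          ((Fintype.card G : ℂ))⁻¹ * ((Fintype.card G : ℂ))⁻¹ else 0 := by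
      intro j
      by_cases hj : ∀ b', b' ≠ b → k b' = j b'
      · have hj' : ∀ b', b' ≠ b → j b' = k' b' := fun b' hb' => (hj b' hb').symm.trans (h b' hb')
        rw [if_pos hj, if_pos hj', if_pos]
        refine Finset.mem_image.2 ⟨j b, Finset.mem_univ _, funext fun b' => ?_⟩
        by_cases hb' : b' = b
        · subst hb'; rw [Function.update_self]
        · rw [Function.update_of_ne hb', hj b' hb']
      · rw [if_neg hj, zero_mul, if_neg]
        rintro hmem
        obtain ⟨g, -, rfl⟩ := Finset.mem_image.1 hmem
        exact hj fun b' hb' => (Function.update_of_ne hb' g k).symm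
    simp only [hS]
    rw [← Finset.sum_filter, Finset.filter_mem_eq_inter, Finset.univ_inter, Finset.sum_const,
      Finset.card_image_of_injective _ (fun g g' hgg' => by
        simpa using congrFun hgg' b), Finset.card_univ, nsmul_eq_mul]
    have hG : (Fintype.card G : ℂ) ≠ 0 := Nat.cast_ne_zero.2 Fintype.card_ne_zero
    field_simp
  · rw [if_neg h]
    refine Finset.sum_eq_zero fun j _ => ?_
    by_cases hj : ∀ b', b' ≠ b → k b' = j b'
    · rw [if_neg (show ¬ (∀ b', b' ≠ b → j b' = k' b') from
        fun hj' => h fun b' hb' => (hj b' hb').trans (hj' b' hb')), mul_zero]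
    · rw [if_neg hj, zero_mul]

/-- **`E_b` is idempotent**: the electric energy of a bond is a projector (eigenvalue `0` on the
link functions constant in `u_b`, `1` on their orthogonal complement; a single spin-carrying hop
costs exactly `gE`). [folklore] -/
theorem electricLink_mul_self (b : Bond L) :
    (electricLink L b : Matrix (Bond L → G) _ ℂ) * electricLink L b = electricLink L b := by
  rw [electricLink_eq_one_sub_linkAverage, Matrix.sub_mul, Matrix.mul_sub, Matrix.mul_sub,
    Matrix.one_mul, Matrix.one_mul, Matrix.mul_one, linkAverage_mul_self, sub_self, sub_zero]

end Projector

/-! ### The Gauss-law subspace, the group average, and Elitzur's theorem -/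

section Elitzur

variable {G : Type*} [Group G] [Fintype G] [DecidableEq G]
variable (ρ : G →* Matrix (Fin 2) (Fin 2) ℂ) (L : ℕ) [NeZero L]

/-- Membership in the gauge-invariant subspace: `W(η) ψ = ψ` for all `η`. [folklore] -/
theorem mem_gaugeInvariantSubspace_iff (ψ : Index L G → ℂ) :
    ψ ∈ gaugeInvariantSubspace ρ L ↔ ∀ η : FermionTorus 2 L → G, gaugeTransform ρ L η *ᵥ ψ = ψ := by
  simp only [gaugeInvariantSubspace, Submodule.mem_iInf, LinearMap.mem_ker, LinearMap.sub_apply,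
    Matrix.toLin'_apply, LinearMap.id_apply, sub_eq_zero]

/-- `Σ_η W(η' η) = Σ_η W(η)` (reindexing the group sum). [folklore] -/
theorem sum_gaugeTransform_mul_left (η' : FermionTorus 2 L → G) :
    ∑ η : FermionTorus 2 L → G, gaugeTransform ρ L (η' * η) =
      ∑ η : FermionTorus 2 L → G, gaugeTransform ρ L η :=
  Fintype.sum_equiv (Equiv.mulLeft η') _ _ fun _ => rfl

/-- `W(η') P = P` for the group average `P`. [folklore] -/
theorem gaugeTransform_mul_gaugeAverage (η' : FermionTorus 2 L → G) :
    gaugeTransform ρ L η' * gaugeAverage ρ L = gaugeAverage ρ L := by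
  unfold gaugeAverage
  rw [Matrix.mul_smul, Finset.mul_sum]
  simp only [← gaugeTransform_mul]
  rw [sum_gaugeTransform_mul_left]

/-- **The group average is a projector**: `P² = P`. Bietenholz–Wiese (2025) §11.9. [folklore] -/
theorem gaugeAverage_mul_self : gaugeAverage ρ L * gaugeAverage ρ L = gaugeAverage ρ L := by
  nth_rw 1 [gaugeAverage]
  rw [Matrix.smul_mul, Finset.sum_mul]
  simp only [gaugeTransform_mul_gaugeAverage, Finset.sum_const, Finset.card_univ]
  rw [← Nat.cast_smul_eq_nsmul ℂ, smul_smul, inv_mul_cancel₀, one_smul]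
  exact Nat.cast_ne_zero.2 Fintype.card_ne_zero

/-- The group average is Hermitian for a unitary `ρ` (`W(η)ᴴ = W(η⁻¹)` and `η ↦ η⁻¹` permutes the
sum). [folklore] -/
theorem gaugeAverage_isHermitian (hρ : ∀ h : G, ρ h ∈ Matrix.unitaryGroup (Fin 2) ℂ) :
    (gaugeAverage ρ L).IsHermitian := by
  unfold gaugeAverage
  rw [Matrix.IsHermitian, Matrix.conjTranspose_smul, Matrix.conjTranspose_sum, star_inv₀,
    star_natCast]
  congr 1
  simp only [gaugeTransform_conjTranspose ρ L hρ]
  exact Fintype.sum_equiv (Equiv.inv _) _ _ fun _ => rfl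

/-- The group average commutes with the Hamiltonian. Bietenholz–Wiese (2025) §11.9. [folklore] -/
theorem commute_gaugeAverage_spinGaugedHubbardTorusWith
    (hρ : ∀ h : G, ρ h ∈ Matrix.unitaryGroup (Fin 2) ℂ) (U gE gB : ℝ) :
    Commute (gaugeAverage ρ L) (spinGaugedHubbardTorusWith ρ L U gE gB) := by
  unfold gaugeAverage
  refine Commute.smul_left (Commute.sum_left _ _ _ fun η _ => ?_) _
  exact commute_gaugeTransform_spinGaugedHubbardTorusWith ρ L hρ η U gE gB

/-- Gauge-invariant vectors are exactly the vectors fixed by the group average. [folklore] -/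
theorem gaugeAverage_mulVec_eq_self_iff (ψ : Index L G → ℂ) :
    gaugeAverage ρ L *ᵥ ψ = ψ ↔ ψ ∈ gaugeInvariantSubspace ρ L := by
  rw [mem_gaugeInvariantSubspace_iff]
  constructor
  · intro h η
    rw [← h, Matrix.mulVec_mulVec, gaugeTransform_mul_gaugeAverage]
  · intro h
    unfold gaugeAverage
    rw [Matrix.smul_mulVec, Matrix.sum_mulVec]
    simp only [h, Finset.sum_const, Finset.card_univ]
    rw [← Nat.cast_smul_eq_nsmul ℂ, smul_smul, inv_mul_cancel₀, one_smul]
    exact Nat.cast_ne_zero.2 Fintype.card_ne_zero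

/-- The group average maps every vector into the Gauss-law subspace (the range of the projector
`P`). [folklore] -/
theorem gaugeAverage_mulVec_mem (φ : Index L G → ℂ) :
    gaugeAverage ρ L *ᵥ φ ∈ gaugeInvariantSubspace ρ L := by
  rw [← gaugeAverage_mulVec_eq_self_iff, Matrix.mulVec_mulVec, gaugeAverage_mul_self]

/-- **Elitzur's theorem, Hamiltonian form (abstract)**: in a vector fixed by a family of matrices
`W h`, the expectation of `A` equals that of each conjugate `W(h)ᴴ A W(h)`; hence if the group
sum `Σ_h W(h)ᴴ A W(h)` vanishes, so does `⟨ψ, A ψ⟩` — "local quantities without a gauge-invariant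
component have zero expectation; only gauge-invariant operators can acquire expectation values".
Elitzur, Phys. Rev. D 12 (1975) 3978. [cite: Elitzur1975] -/
theorem dotProduct_mulVec_eq_zero_of_sum_conj_eq_zero {ι K : Type*} [Fintype ι] [Fintype K]
    [Nonempty K] (W : K → Matrix ι ι ℂ) (A : Matrix ι ι ℂ) (ψ : ι → ℂ)
    (hψ : ∀ h, W h *ᵥ ψ = ψ) (hA : ∑ h, (W h)ᴴ * A * W h = 0) : star ψ ⬝ᵥ (A *ᵥ ψ) = 0 := by
  have hconj : ∀ h, star ψ ⬝ᵥ (A *ᵥ ψ) = star ψ ⬝ᵥ (((W h)ᴴ * A * W h) *ᵥ ψ) := by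
    intro h
    conv_lhs => rw [← hψ h]
    rw [Matrix.star_mulVec, ← Matrix.dotProduct_mulVec, Matrix.mulVec_mulVec, Matrix.mulVec_mulVec,
      Matrix.mul_assoc]
  have hsum : (Fintype.card K : ℂ) * (star ψ ⬝ᵥ (A *ᵥ ψ)) =
      star ψ ⬝ᵥ ((∑ h, (W h)ᴴ * A * W h) *ᵥ ψ) := by
    rw [Matrix.sum_mulVec, dotProduct_sum, ← Finset.card_univ, ← nsmul_eq_mul,
      ← Finset.sum_const]
    exact Finset.sum_congr rfl fun h _ => hconj h
  rw [hA, Matrix.zero_mulVec, dotProduct_zero] at hsum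
  exact (mul_eq_zero.1 hsum).resolve_left (Nat.cast_ne_zero.2 Fintype.card_ne_zero)

omit [Fintype G] [DecidableEq G] [NeZero L] in
/-- Conjugating a fermionic spin bilinear by a gauge transformation (unitary `ρ`):
`Γ(η)ᴴ S_{x,x'}(A) Γ(η) = S_{x,x'}(ρ(η_x)ᴴ A ρ(η_{x'}))`. [folklore] -/
theorem conj_fermionGauge_spinBil (hρ : ∀ h : G, ρ h ∈ Matrix.unitaryGroup (Fin 2) ℂ)
    (η : FermionTorus 2 L → G) (x x' : FermionTorus 2 L) (A : Matrix (Fin 2) (Fin 2) ℂ) :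
    (fermionGauge ρ L η)ᴴ * spinBil x x' A * fermionGauge ρ L η =
      spinBil x x' ((ρ (η x))ᴴ * A * ρ (η x')) := by
  have h : fermionGauge ρ L η * spinBil x x' ((ρ (η x))ᴴ * A * ρ (η x')) =
      spinBil x x' (ρ (η x) * ((ρ (η x))ᴴ * A * ρ (η x')) * (ρ (η x'))ᴴ) * fermionGauge ρ L η :=
    Gamma_spinRotation_mul_spinBil (fun y => hρ (η y)) x x' _
  have hsimp : ρ (η x) * ((ρ (η x))ᴴ * A * ρ (η x')) * (ρ (η x'))ᴴ = A := by
    rw [← Matrix.mul_assoc, ← Matrix.mul_assoc, rep_mul_conjTranspose_self ρ hρ, Matrix.one_mul,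
      Matrix.mul_assoc, rep_mul_conjTranspose_self ρ hρ, Matrix.mul_one]
  rw [hsimp] at h
  rw [Matrix.mul_assoc, ← h, ← Matrix.mul_assoc, fermionGauge_conjTranspose_mul_self ρ L hρ,
    Matrix.one_mul]

/-- **Elitzur for the spin, general `G`**: let `M` be a coefficient matrix whose group average
`Σ_{h∈G} ρ(h)ᴴ M ρ(h)` vanishes (for `Q₈`: every traceless `M` — every spin component — by
`Q8.sum_conjTranspose_rep_mul_mul_rep`). Then `⟨ψ, (S_{y,y}(M) ⊗ 1) ψ⟩ = 0` in every state obeying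
the Gauss law at `y` (`W(Pi.mulSingle y h) ψ = ψ` for all `h ∈ G`). Elitzur (1975);
Fradkin–Shenker (1979) §II. [cite: Elitzur1975] -/
theorem expect_spinOp_eq_zero (hρ : ∀ h : G, ρ h ∈ Matrix.unitaryGroup (Fin 2) ℂ)
    (y : FermionTorus 2 L) (M : Matrix (Fin 2) (Fin 2) ℂ)
    (hM : ∑ h : G, (ρ h)ᴴ * M * ρ h = 0)
    (ψ : Index L G → ℂ) (hψ : ∀ h : G, gaugeTransform ρ L (Pi.mulSingle y h) *ᵥ ψ = ψ) :
    star ψ ⬝ᵥ ((spinBil y y M ⊗ₖ (1 : Matrix (Bond L → G) (Bond L → G) ℂ)) *ᵥ ψ) = 0 := by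
  refine dotProduct_mulVec_eq_zero_of_sum_conj_eq_zero
    (fun h : G => gaugeTransform ρ L (Pi.mulSingle y h)) _ ψ hψ ?_
  simp only [conj_gaugeTransform_kronecker_one, conj_fermionGauge_spinBil ρ L hρ, Pi.mulSingle_eq_same]
  rw [← sum_kronecker, ← spinBil_sum, hM, spinBil_zero, Matrix.zero_kronecker]

/-- **Elitzur for spin two-point functions, general `G`**: for `x ≠ y` and `M'` with vanishing
group average, `⟨ψ, (S_{x,x}(M) S_{y,y}(M') ⊗ 1) ψ⟩ = 0` in every state obeying the Gauss law at
`y` — no spin-vector two-point function, hence no spin long-range order, survives the gauging.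
Elitzur (1975). [cite: Elitzur1975] -/
theorem expect_spinOp_mul_spinOp_eq_zero (hρ : ∀ h : G, ρ h ∈ Matrix.unitaryGroup (Fin 2) ℂ)
    {x y : FermionTorus 2 L} (hxy : x ≠ y) (M M' : Matrix (Fin 2) (Fin 2) ℂ)
    (hM' : ∑ h : G, (ρ h)ᴴ * M' * ρ h = 0)
    (ψ : Index L G → ℂ) (hψ : ∀ h : G, gaugeTransform ρ L (Pi.mulSingle y h) *ᵥ ψ = ψ) :
    star ψ ⬝ᵥ (((spinBil x x M * spinBil y y M') ⊗ₖ
      (1 : Matrix (Bond L → G) (Bond L → G) ℂ)) *ᵥ ψ) = 0 := by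
  refine dotProduct_mulVec_eq_zero_of_sum_conj_eq_zero
    (fun h : G => gaugeTransform ρ L (Pi.mulSingle y h)) _ ψ hψ ?_
  have hsplit : ∀ h : G, (fermionGauge ρ L (Pi.mulSingle y h))ᴴ * (spinBil x x M * spinBil y y M') *
      fermionGauge ρ L (Pi.mulSingle y h) =
      spinBil x x M * spinBil y y ((ρ h)ᴴ * M' * ρ h) := by
    intro h
    have hU : fermionGauge ρ L (Pi.mulSingle y h) * (fermionGauge ρ L (Pi.mulSingle y h))ᴴ = 1 :=
      fermionGauge_mul_conjTranspose ρ L hρ _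
    calc (fermionGauge ρ L (Pi.mulSingle y h))ᴴ * (spinBil x x M * spinBil y y M') *
          fermionGauge ρ L (Pi.mulSingle y h)
        = ((fermionGauge ρ L (Pi.mulSingle y h))ᴴ * spinBil x x M *
            fermionGauge ρ L (Pi.mulSingle y h)) *
          ((fermionGauge ρ L (Pi.mulSingle y h))ᴴ * spinBil y y M' *
            fermionGauge ρ L (Pi.mulSingle y h)) := by
          simp only [Matrix.mul_assoc]
          rw [← Matrix.mul_assoc (fermionGauge ρ L (Pi.mulSingle y h))
            (fermionGauge ρ L (Pi.mulSingle y h))ᴴ, hU, Matrix.one_mul]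
      _ = spinBil x x M * spinBil y y ((ρ h)ᴴ * M' * ρ h) := by
          rw [conj_fermionGauge_spinBil ρ L hρ, conj_fermionGauge_spinBil ρ L hρ, Pi.mulSingle_eq_same,
            Pi.mulSingle_eq_of_ne hxy, map_one, Matrix.conjTranspose_one, Matrix.one_mul,
            Matrix.mul_one]
  simp only [conj_gaugeTransform_kronecker_one, hsplit]
  rw [← sum_kronecker, ← Finset.mul_sum, ← spinBil_sum, hM', spinBil_zero, Matrix.mul_zero,
    Matrix.zero_kronecker]

end Elitzur

end SpinGauged

/-! ### Elitzur's theorem for the `Q₈`-spin-gauged Hubbard torus of route ColourTheSpin -/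

section Q8Elitzur

open SpinGauged

variable (L : ℕ) [NeZero L]

/-- The `Q₈` group average of a traceless coefficient matrix vanishes (Schur,
`Q8.sum_conjTranspose_rep_mul_mul_rep`). [folklore] -/
theorem Q8.sum_conjTranspose_rep_mul_mul_rep_eq_zero {M : Matrix (Fin 2) (Fin 2) ℂ}
    (hM : M.trace = 0) : ∑ u : Q8, (Q8.rep u)ᴴ * M * Q8.rep u = 0 := by
  rw [Q8.sum_conjTranspose_rep_mul_mul_rep, hM, mul_zero, zero_smul]

/-- **No spin expectation survives the `Q₈` gauging**: for every traceless `M` (every spin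
component `S^a_y = S_{y,y}(σ^a/2)`, `a = x, y, z`) and every state `ψ` of the `Q₈`-spin-gauged
Hubbard torus obeying the Gauss law at `y`, `⟨ψ, (S_{y,y}(M) ⊗ 1) ψ⟩ = 0` — Néel, spiral,
spin-stripe and ferromagnetic order parameters all have identically vanishing expectation, for
every gauge coupling. Elitzur (1975) (impossibility of spontaneously breaking a local symmetry),
Hamiltonian form. [cite: Elitzur1975] -/
theorem q8_expect_spinOp_eq_zero (y : FermionTorus 2 L) {M : Matrix (Fin 2) (Fin 2) ℂ}
    (hM : M.trace = 0) (ψ : SpinGauged.Index L Q8 → ℂ)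
    (hψ : ∀ h : Q8, gaugeTransform Q8.rep L (Pi.mulSingle y h) *ᵥ ψ = ψ) :
    star ψ ⬝ᵥ ((spinBil y y M ⊗ₖ (1 : Matrix (Bond L → Q8) (Bond L → Q8) ℂ)) *ᵥ ψ) = 0 :=
  expect_spinOp_eq_zero Q8.rep L Q8.rep_mem_unitaryGroup y M
    (Q8.sum_conjTranspose_rep_mul_mul_rep_eq_zero hM) ψ hψ

/-- **No spin two-point function survives the `Q₈` gauging**: for `x ≠ y`, traceless `M'` and
a state obeying the Gauss law at `y`, `⟨ψ, (S_{x,x}(M) S_{y,y}(M') ⊗ 1) ψ⟩ = 0`; in particular no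
spin long-range order of any kind in any gauge-invariant state of `H_g(L, U)`. Elitzur (1975).
[cite: Elitzur1975] -/
theorem q8_expect_spinOp_mul_spinOp_eq_zero {x y : FermionTorus 2 L} (hxy : x ≠ y)
    (M : Matrix (Fin 2) (Fin 2) ℂ) {M' : Matrix (Fin 2) (Fin 2) ℂ} (hM' : M'.trace = 0)
    (ψ : SpinGauged.Index L Q8 → ℂ)
    (hψ : ∀ h : Q8, gaugeTransform Q8.rep L (Pi.mulSingle y h) *ᵥ ψ = ψ) :
    star ψ ⬝ᵥ (((spinBil x x M * spinBil y y M') ⊗ₖ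
      (1 : Matrix (Bond L → Q8) (Bond L → Q8) ℂ)) *ᵥ ψ) = 0 :=
  expect_spinOp_mul_spinOp_eq_zero Q8.rep L Q8.rep_mem_unitaryGroup hxy M M'
    (Q8.sum_conjTranspose_rep_mul_mul_rep_eq_zero hM') ψ hψ

/-- **`H_g(L, U)` is Hermitian for every `SU(2)`-valued representation** (the hypothesis of
`isHermitian_spinGaugedHubbardTorusWith` discharged by `star_trace_rep_of_mem`). [folklore] -/
theorem isHermitian_spinGaugedHubbardTorusWith_of_mem {G : Type*} [Group G] [Fintype G]
    [DecidableEq G] (ρ : G →* Matrix (Fin 2) (Fin 2) ℂ)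
    (hρ : ∀ h : G, ρ h ∈ Matrix.specialUnitaryGroup (Fin 2) ℂ) (U gE gB : ℝ) :
    (spinGaugedHubbardTorusWith ρ L U gE gB).IsHermitian :=
  isHermitian_spinGaugedHubbardTorusWith ρ L (star_trace_rep_of_mem ρ hρ) U gE gB

end Q8Elitzur

end Literature.MathematicalPhysics.QuantumLattice
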